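import Summits.AtomisticToContinuum.HydrodynamicLimit.Theorems.CollisionIsometryCLTAdaptedWeightCLTLine
import Summits.AtomisticToContinuum.HydrodynamicLimit.Theses.StiffCollisionalRelaxation
import Summits.AtomisticToContinuum.HydrodynamicLimit.Theorems.AdaptedWeightCLT.Negative.MechanismToys
import Summits.AtomisticToContinuum.HydrodynamicLimit.Theorems.AdaptedWeightCLT.Negative.CubicProbeDeficiency

/-!
# Disproof workfile — crux `AdaptedWeightCLT` (stmt-AtomisticToContinuum-14868, rev-12 TIME-LOCAL form of ex stmt-12949)

Standing adversary of the crux (cdisprove seat `refuter-cdisprove-stmt-AtomisticToContinuum-14868-0`; earlier cycles on the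
rev-11 item stmt-12949 by seats `…-12949-0` (cycle 1) and `…-12949-g2-0` (cycle 2)), route `CollisionIsometryCLT`,
sub-problem `HydrodynamicLimit`.  Everything below is `lean check`ed (rc 0, no `sorry`, no warnings); prose lives in
docstrings.  CYCLE 3 (2026-08-16) = cycle 1 on stmt-14868: REBASED on the rev-12 text (the cycle-1 file no longer
elaborated: its `Iff.rfl` bridges targeted the rev-11 crux and the retired `CollisionIsometryCLT.FastMomentRelaxation`).

## Verdict: NO KILL of the crux as typed — why it resists, and what was found instead

Shape (rev 12): `∀ profiles ∃ σ₀ ∀ σ < σ₀ ∀ Φ, H1(σ,Φ) → ∀ kernels ∀ t > 0, H2(σ,Φ,t) → C(σ,Φ,t)` with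
H1 = conclusion of `DiffuseBackwardInfluence` (mean ipr of the frozen-geometry transfer → 0 on every kinetic window),
H2(t) = time-averaged one-particle exponential velocity moment on `[0,t]` bounded w.h.p. (= (i) of `AprioriBoundsPreShock` at `t`),
C(t) = block traceless kinetic stress `D` and kinetic heat flux `q` vanish in `L²([0,t] × 𝕋³)` in probability.

(F1) STRUCTURAL, survives rev 12 (§1): the UNCONDITIONAL kinetic hinge stmt-9522 (`StiffCollisionalRelaxation.
  FastMomentRelaxation`, = `KineticClosure` here by `Iff.rfl`) implies the crux and each hypothesis-dropped variant
  (`WithoutDiffuse`, `WithoutTails`): H1, H2 are proof aids, not truth conditions; no `_false_without_` certificate exists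
  while 9522 stands.  NEW: since rev 12 THIS route's target `FastMomentRelaxationPreShock` (Euler-conditioned, `t < T`,
  dilute chamber) does NOT imply the crux — the crux is claimed for all `t > 0` and all flows, strictly more than `closes`
  consumes.  §1c types the consumed part `PreShock` (= C′) and checks `Named → PreShock` and
  `DiffuseBackwardInfluence → PreShock → AprioriBoundsPreShock → FastMomentRelaxationPreShock` (and `closes` re-run):
  the post-shock surplus of the crux is NOT load-bearing.  Prepared classification: a post-shock witness (the one
  candidate mechanism, §6: sub-block Kelvin–Helmholtz / Richtmyer–Meshkov Reynolds stress in the inviscid band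
  `N^{-1/6} ≪ ℓ ≪ N^{-γ}`, H1 and H2 intact — itself doubtful at fixed `γ`: Kolmogorov share `N^{-2γ/3} → 0`) would be
  `refuted-misstated`, repaired statement C′ = `PreShock`, route intact.
(F2) LINE `contact-source-duhamel`, `stub_pastDamping` — CLOUD LOCALITY IS NOT FREE (§5a, `cradle_relay`,
  `vcradle_relay`): along a chain of `m` collisions with normals along the carried direction the incoherent transport
  moves an injected piece `n^{⊗r}` from carrier `0` to carrier `m` intact (every rank), i.e. by `m·ε_N` in space in
  arbitrarily short time while no sphere moves more than the gaps (Newton's cradle); the velocity transfer relays too.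
  The stub's sketch bounds its weight-gradient term by `‖∇φ_N‖_∞ × (cloud displacement ≤ VΔℓ_N + hops·ε_N)`; the hop
  count / chain reach is controlled by NEITHER hypothesis of the stub (`CDAlongAt`: a mean depolarisation, blind to where
  pieces sit; `TailsOn`: one-particle velocity tails, blind to positions and collision counts), the stub is claimed for ALL
  `σ < 1/2` and all `Φ` with no H1, and entropy transfer cannot supply it along the evolved law (a supersonic chain over
  `N^{-4γ}` costs `e^{-O(N^{1/3−4γ})}` under `G_N`, sub-exponential).  Not a refutation (the real dilute flow very likely
  IS cloud-local w.h.p.), but a missing input: the mass-weighted cloud displacement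
  `(N+1)⁻¹ Σ_k Σ_i tr 𝒯(δ_k y_k y_kᵀ)_i · min(1, N^{4γ} d(x_i(s), x_k(s)))` must be `o(1)` in `L¹(ds dP)` — a
  `CloudLocalityOn t` stub/hypothesis, or a re-cut of PAST's bookkeeping that keeps the test on the source particle.
  In dense post-implosion transients chain ("sound") speed diverges near jamming: the same `∀ t > 0` exposure as (F1).
(F3) LINE, `stub_contactCrossNull` / `stub_sourceContraction` — THE CLOSURE DEBT, CHECKED (§5b,
  `chaosCross_tet_ne_zero` with `tet_sum/tet_second/tet_flux`): the regular-tetrahedron block law has `D = 0`, `q = 0`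
  exactly, yet the line's own `chaosCross 2` at the normal `(1,2,0)` has `(0,0)` entry `4/125 ≠ 0`.  So C at time `s`
  does not make the chaos value of the sources small; given Duhamel + dictionary + PastSmall (+ C), CCN ⟺
  `∫∫Σ(Ξ^ch)² → 0`, which is NOT implied by 9522: CCN/SC assert flux-level (fourth-cumulant) local equilibrium of the
  block law along the flow.  No pointwise inequality with margin exists; only the in-probability, along-the-flow form
  can hold — as the line card concedes; this is its smallest checked instance and a unit test for the provers.
(F4) LINE, `stub_contactCrossNull` — its ABSOLUTE form is an INERT LEVER at fixed `σ` (§5c, `CrossNullRelOn`; stub note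
  `stub-misstated: stub_contactCrossNull — relative form` on the item): pre-collisional pair velocities at contact factorise
  EXACTLY only under the equilibrium Gibbs law; off equilibrium rings / prompt recollisions give the flux-weighted bilinear source
  statistic a STATIC relative defect `c₁(σ) = O(σ³) ≠ 0`, first order in the anisotropy and `N`-independent, so
  `∫∫Σ(Ξ − Ξ^ch)² → 0` at fixed `σ` forces the anisotropy itself to vanish — it holds only THROUGH C.  MEASURED on deterministic
  hard spheres (kit j017504 / j017558 / j017568 / j017633; periodic cube, `N = 16384`, homogeneous, positions equilibrated,
  velocities reset to a PRODUCT anisotropic Gaussian `diag(2, ½, ½)`; per collision the actual rank-2 source of both partners vs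
  `2·chaosCross` of the CURRENT empirical law with the line's flux weight `|⟪W_k − W_k', n⟫|`, 400 MC pairs; 8 seeds,
  ≈ 1.6·10⁵ collisions per density, pooled over 0.5–3 collisions/particle): relative defect `(S − C)/C = −4.5 ± 4.1 %`
  (`φ = 0.01`, `d/ℓ = 6√2 φ = 0.085`), `−3.3 ± 4.2 %` (0.02), `−8.3 ± 2.9 %` (0.05), `−12.7 ± 2.9 %` (0.10), `−16.4 ± 2.8 %` (0.20),
  `−21.3 ± 2.7 %` (0.30) — the ACTUAL restoring source is weaker than its chaos value, monotonically in density, consistent with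
  `0` as `φ → 0`; time step ÷3 reproduces `−18.1 ± 2.9 %` at `φ = 0.2` (physical, not a stepping artefact); the first half
  collision/particle restricted to fresh contacts is a clean null (`+0.002 / +0.016 ± 0.010 / +0.006 ± 0.010`); the deviation is
  carried by FRESH contacts (genuine recollisions), the lingering-overlap class being `0.3 / 2.2 / 4.8 %` of collisions; a
  velocity-shuffle control (j017548) was invalid by design and is discarded.  Corrected signature: the RELATIVE form
  `CrossNullRelOn … t c` with `c(σ)` carried into `stub_reduction`'s margin (`κ + η + c/(2η) < 1`); `∃ σ₀` gets the job.
(F5) MECHANISM TOYS (cycles 1–2, landed): ¬(S1) `diffuse_rows_need_not_isotropise`, ¬(S2)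
  `adapted_unit_rows_need_not_centre`, (S3) `reflectVel_of_inner_eq_zero`, (S4) `one_reflection_covariance`, weight
  split `9 → 5`; `cubic_probe_deficiency` / `tpow_three_polarization` (six probes lie on `xyz = 0`; ten suffice) — the
  lead re-typed `CDAlongAt` with `cd3x` accordingly.
(F6) NO FORMALISATION LEVER in the rev-12 text (§6 re-audit): unchanged bodies of H1, C, kernels, `let`s; only the
  position of H2 moved.

## Landed through the gate (importable; namespace `…Theorems.AdaptedWeightCLTNegative` unless stated)
* `Theorems/AdaptedWeightCLT/Negative/MechanismToys.lean` (p73057): §2–§4 toys.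
* `Theorems/AdaptedWeightCLT/Negative/CubicProbeDeficiency.lean` (p84881): `cubic_probe_deficiency`,
  `tpow_three_polarization`, `pairT_C3_tpow`, `dirV_coord_prod`.
* THIS CYCLE — LANDED: `Negative/PreShockSuffices.lean` (p103094, commit fe8901cb5df7; §1c in negative dress:
  `adaptedWeightCLT_false_of_not_preShock`, `not_preShock_of_not_target`, `not_preShock_of_not_hydrodynamicLimit`; p100315,
  whose closed `def AdaptedWeightCLTPreShock : Prop` the gate RELOCATED to `Literature/Uncategorized/AdaptedWeightCLTPreShock.lean`,
  p99801, because its docstring carried a `[folklore]` tag — both BOUNCED (the relocated file cannot elaborate outside Summits);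
  re-proposed with the def deliberately UNTAGGED — lesson for seats: tag theorems, not candidate-restatement defs);
  LANDED: `Negative/StubContactCrossNullClosureDebt.lean` (p102205, commit 5f37abe342be; §5b, def-free: `tet`/`ntet` are local
  notations there, packaged as `closure_debt_witness`; review ACCEPT: `4/125` independently recomputed); PENDING:
  `Negative/StubPastDampingCloudRelay.lean` (§5a; p102209 → review revise: import the lead's rev-12 helpers instead of
  copies → re-proposed as p104451).

## Index
* §0 `transfer`, `ipr`, `Named` (rev 12), `adaptedWeightCLT_iff_named` (`Iff.rfl`), `iprF_eq_ipr` (line vocabulary = this file's).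
* §1a `Rev11`, `rev11_of_named`; §1b `WithoutDiffuse`, `WithoutTails`, `KineticClosure`, `kineticClosure_iff_fmr9522`
  (`Iff.rfl`), `withoutDiffuse/withoutTails_of_kineticClosure`, `not_fmr9522_of_not_without`, `adaptedWeightCLT_of_fmr9522`;
  §1c `PreShock`, `preShock_of_named`, `fmrPreShock_of_preShock`, `hydrodynamicLimit_of_preShock`, `assembly_with_preShock`.
* §2 `transfer_of_collisionCount_eq_zero`, `ipr_identity`, `ipr_of_collisionCount_eq_zero`, `row_ipr_floor`.
* §3 `diffuse_rows_need_not_isotropise`, `adapted_unit_rows_need_not_centre`, `reflectVel_of_inner_eq_zero`,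
  `one_reflection_covariance`; §4 `partner_weight_after_reflection`, `self_weight_after_reflection`.
* §5a `pinch`, `cradle`, `cradle_relay`, `cradle_relay_trace`, `cradle_relay_of_ne`, `vpinch`, `vcradle`, `vcradle_relay`
  (+ tensor helpers `mapT_projM_tpow_self`, `mapT_coprojM_tpow_self`, …); §5b `crossT_two_apply`, `tet`, `ntet`,
  `tet_sum`, `tet_second`, `tet_flux`, `chaosCross_tet_ne_zero`.
* §5c `AdmissibleKernel'`, `CrossNullRelOn` (suggested corrected signature of `stub_contactCrossNull`; toy table in (F4)).
* §6 dead kill patterns (rev 12), incl. the post-shock KH analysis and why no `H → ¬crux` lemma is filed.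

## Small-model computations — cycle 3: (a) the CCN static-defect toy of (F4); (b) the CD toy for `stub_columnDepolarisation`
(kit j017690, `ccn/cdtoy.py`, note `stub_columnDepolarisation_cdtoy.md` on the item): deterministic hard spheres at EQUILIBRIUM,
N = 8192, φ = 0.05 / 0.2, 64 sources × 3 impulses tracked exactly along the realised collisions — the incoherent cloud depolarisation
(`cd2`'s summand) is SLAVED to ipr one-to-one: `dep2/(2/3) ≈ (1.0–1.2)·ipr/9` over two decades, decay rates per collision/particle
ipr 0.33, dep2 0.31 (the route's MD value 0.30–0.35); coherent column cloud vs incoherent `𝒯` cloud agree to 1 % up to 2 cpp and to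
≤ 20 % at 8 cpp (stub 3's caveat (b) is small; the incoherent cloud is the MORE depolarised); the first collision contracts the traceless
cloud stress as the uniform-normal `3/5` predicts (`0.69 ≈ e^{-2/5}`), the population rate then slows to `e^{-0.31/cpp}` (collision-rate
heterogeneity) — rates must be phrased per realised own-collision count.  (a) the CCN static-defect toy of (F4) (kit j017504 / j017548 / j017556 / j017558 / j017568 /
j017633, evidence `compute-j0175xx.json` on stmt-14868, script `ccn/main.py` in the seat folder, tables in the stub note).  Cycle 1 (kit j008384, evidence `compute-j008384.json` on stmt-12949; DSMC caricature,
N = 1000, exact transfer carried): ipr/9 ≈ e^{-0.42c} per collision/particle initially (one-collision factor 5/9 exact);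
hard-sphere kernel isotropises stress FASTER (×0.42/epoch) than it delocalises rows; kurtosis relaxes with no residual
tilt but the frozen-weight Lindeberg prediction is off by relative factors 1.3–2 under the ADAPTED kernel — the regime of
H1 and the regime of C coincide (collision count → ∞); no counterexample pattern to transplant.

## Literature (page-verified in cycle 1 where marked; cycle-3 searches in the seat's NOTES.md)
* "CLT ⇒ Maxwellian" exists in print only for Maxwellian molecules / Kac (Cercignani–Gabetta 2007 ch. 2, pp. 29, 37,
  verified); nothing for the hard-sphere kernel, nothing for the deterministic flow.
* Post-shock fine-scale structure from molecular data: large-scale MD of Rayleigh–Taylor / Richtmyer–Meshkov /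
  Kelvin–Helmholtz instabilities (Kadau–Germann–Hadjiconstantinou–… 2004 PNAS; 2010 Phil. Trans.) — the empirical
  reason the crux's `∀ t > 0` is an exposure and `PreShock` the safe form (see NOTES for the search record).
-/

namespace Summit.AtomisticToContinuum.HydrodynamicLimit.Cruxes.AdaptedWeightCLT.Disproof

open scoped BigOperators Topology Classical MeasureTheory ProbabilityTheory Matrix InnerProductSpace
open Filter Set Function TopologicalSpace MeasureTheory Finset
open Summit.AtomisticToContinuum.HydrodynamicLimit.Theses.CollisionIsometryCLT
open Literature.Analysis.FluidPDE Literature.MathematicalPhysics.KineticTheory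

noncomputable section

/-! ## §0 Named copies of the crux's inlined objects (rev 12) -/

/-- The frozen-geometry velocity transfer of the crux (verbatim the body of its `let M`): the fold of
the linear collision reflections `collidePair` at the realised pre-collisional positions of the
Alexander construction started at `y`, over the collisions in the window `[0, Δ]`, applied to the
velocity field `W`.  (Definitionally the line's `transferSteps σ N y (steps σ N y Δ) W`.) -/
def transfer (σ : ℝ) (N : ℕ) (y : Config (N + 1) (Fin 3) T3) (Δ : ℝ) (W : Fin (N + 1) → V3) :
    Fin (N + 1) → V3 :=
  (let G := Literature.Analysis.FluidPDE.Torus.geometry (Fin 3); let ε : ℝ := Literature.MathematicalPhysics.KineticTheory.hsDiameter σ N; let pre := fun k : ℕ => (let zk := Literature.Analysis.FluidPDE.Alexander.stateAfter G ε y k; Literature.Analysis.FluidPDE.freeFlight G (Literature.Analysis.FluidPDE.Alexander.freeExitTime G ε zk).toReal zk); (List.range (Literature.Analysis.FluidPDE.Alexander.collisionCount G ε y Δ)).foldl (fun W' k => @dite (Fin (N + 1) → EuclideanSpace ℝ (Fin 3)) (Literature.Analysis.FluidPDE.Alexander.incomingPairs G ε (pre k)).Nonempty (Classical.propDecidable _)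 (fun h => fun i => (Literature.Analysis.FluidPDE.collidePair G h.some.1 h.some.2 (fun j => ((pre k j).1, W' j)) i).2) (fun _ => W')) W)

/-- The mean inverse participation ratio of the rows of `transfer` (verbatim the crux's `let ipr`):
`(N+1)⁻¹ ∑ᵢ ∑ₖ ‖M_ik‖_F⁴`. -/
def ipr (σ : ℝ) (N : ℕ) (y : Config (N + 1) (Fin 3) T3) (Δ : ℝ) : ℝ :=
  ((N + 1 : ℕ) : ℝ)⁻¹ * ∑ i : Fin (N + 1), ∑ k : Fin (N + 1),
    (∑ a : Fin 3, ‖transfer σ N y Δ (Pi.single k (EuclideanSpace.single a (1 : ℝ))) i‖ ^ 2) ^ 2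

/-- The rev-12 crux with the two `let`s replaced by the named `transfer` / `ipr` (otherwise verbatim):
`∀ profiles ∃ σ₀ ∀ σ < σ₀ ∀ Φ, H1(σ,Φ) → ∀ kernels, ∀ t > 0, H2(σ,Φ,t) → C(σ,Φ,t)`. -/
def Named : Prop :=
  ∀ (a₀ θ₀ : (UnitAddTorus (Fin 3)) → ℝ) (u₀ : (UnitAddTorus (Fin 3)) → (EuclideanSpace ℝ (Fin 3))), Continuous a₀ → Continuous θ₀ → Continuous u₀ → (∀ x, 0 < a₀ x) → (∀ x, 0 < θ₀ x) → ∃ σ₀ : ℝ, 0 < σ₀ ∧ ∀ σ : ℝ, 0 < σ → σ < σ₀ → ∀ Φ : (N : ℕ) → Literature.Analysis.FluidPDE.HardSphereFlow (Literature.Analysis.FluidPDE.Torus.geometry (Fin 3)) (Literature.MathematicalPhysics.KineticTheory.hsDiameter σ N) (N + 1), (∀ Δ : ℕ → ℝ, (∀ N, 0 < Δ N) → Tendsto Δ atTop (𝓝 0) → Tendsto (fun N : ℕ => Δ N * ((N + 1 : ℕ) : ℝ) ^ ((1 : ℝ) / 3)) atTop atTop → ∀ t : ℝ, 0 < t → Tendsto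 (fun N : ℕ => ∫⁻ z, ENNReal.ofReal (ipr σ N ((Φ N).flow (t - Δ N) z) (Δ N)) ∂(Literature.MathematicalPhysics.KineticTheory.localGibbsLaw σ a₀ u₀ θ₀ N (Φ N))) atTop (𝓝 0)) → ∀ (γ C : ℝ) (φ : ℕ → (UnitAddTorus (Fin 3)) → ℝ), 0 < γ → γ ≤ 1 / 15 → ((∀ N, Literature.Analysis.FunctionSpaces.Torus.IsSmooth (φ N)) ∧ (∀ N y, 0 ≤ φ N y) ∧ (∀ N, ∫ y, φ N y = 1) ∧ (∀ (N : ℕ) y, ((N : ℝ) + 1) ^ (-γ) ≤ Literature.Analysis.FluidPDE.Torus.euclidDist y 0 → φ N y = 0) ∧ (∀ (N : ℕ) y, φ N y ≤ C * ((N : ℝ) + 1) ^ (3 * γ)) ∧ (∀ (N : ℕ) y, ‖Literature.Analysis.FunctionSpaces.Torus.gradient (φ N) y‖ ≤ C * ((N : ℝ) + 1) ^ (4 * γ))) → let ρb := fun (N : ℕ) (s : ℝ) z (x : UnitAddTorus (Fin 3)) => Literature.MathematicalPhysics.KineticTheory.empiricalDensityField ((Φ N).flow s z) (fun y => φ N (y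 - x)); let mb := fun (N : ℕ) (s : ℝ) z (x : UnitAddTorus (Fin 3)) => Literature.MathematicalPhysics.KineticTheory.empiricalMomentumField ((Φ N).flow s z) (fun y => φ N (y - x)); let ub := fun (N : ℕ) (s : ℝ) z (x : UnitAddTorus (Fin 3)) => (ρb N s z x)⁻¹ • mb N s z x; let D := fun (N : ℕ) (s : ℝ) z (x : UnitAddTorus (Fin 3)) (j k : Fin 3) => (∫ y, φ N (y.1 - x) * ((y.2 j - ub N s z x j) * (y.2 k - ub N s z x k)) ∂(Literature.Analysis.FluidPDE.empiricalMeasure ((Φ N).flow s z))) - (if j = k then (∑ l : Fin 3, ∫ y, φ N (y.1 - x) * (y.2 l - ub N s z x l) ^ 2 ∂(Literature.Analysis.FluidPDE.empiricalMeasure ((Φ N).flow s z))) / 3 else 0); let q := fun (N : ℕ) (s : ℝ) z (x : UnitAddTorus (Fin 3)) => ∫ y, (φ N (y.1 - x) * ‖y.2 - ub N s z x‖ ^ 2 / 2) • (y.2 - ub N s z x) ∂(Literature.Analysis.FluidPDE.empiricalMeasure ((Φ N).flow s z)); ∀ t : ℝ, 0 < t → (∃ lam Cexp : ℝ, 0 <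 lam ∧ Tendsto (fun N : ℕ => Literature.MathematicalPhysics.KineticTheory.localGibbsLaw σ a₀ u₀ θ₀ N (Φ N) {z | Cexp < ∫ s in Icc 0 t, ∫ y, Real.exp (lam * ‖y.2‖ ^ 2) ∂(Literature.Analysis.FluidPDE.empiricalMeasure ((Φ N).flow s z))}) atTop (𝓝 0)) → ∀ δ : ℝ, 0 < δ → Tendsto (fun N : ℕ => Literature.MathematicalPhysics.KineticTheory.localGibbsLaw σ a₀ u₀ θ₀ N (Φ N) {z | δ < ∫ s in Icc 0 t, ∫ x, ((∑ j, ∑ k, D N s z x j k ^ 2) + ‖q N s z x‖ ^ 2)}) atTop (𝓝 0)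

/-- The named restatement is the crux, definitionally (ζ/δ-reduction). -/
theorem adaptedWeightCLT_iff_named : AdaptedWeightCLT ↔ Named := Iff.rfl

/-- The line's `iprF` (landed vocabulary `Theorems.ContactSourceDuhamel`) is this file's `ipr`, definitionally. -/
theorem iprF_eq_ipr (σ : ℝ) (N : ℕ) (y : Config (N + 1) (Fin 3) T3) (Δ : ℝ) :
    Summit.AtomisticToContinuum.HydrodynamicLimit.Theorems.ContactSourceDuhamel.iprF σ N y Δ = ipr σ N y Δ := rfl

/-! ## §1 Load-bearing analysis after the rev-12 restatement

### §1a rev 11 versus rev 12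
Rev 11 (ex stmt-12949) took H2 at ALL `t > 0` as one global hypothesis placed before the kernel binders; rev 12
asks it per horizon.  The new statement implies the old one (checked: `rev11_of_named`); the converse is not
formal (rev 12 is stronger: closure on `[0,t]` from tails on `[0,t]` only). -/

/-- The rev-11 shape of the crux (ex stmt-12949), over the named `transfer`/`ipr`: H1 → (∀ t > 0, H2(t)) →
kernels → ∀ t > 0, C(t). -/
def Rev11 : Prop :=
  ∀ (a₀ θ₀ : (UnitAddTorus (Fin 3)) → ℝ) (u₀ : (UnitAddTorus (Fin 3)) → (EuclideanSpace ℝ (Fin 3))), Continuous a₀ → Continuous θ₀ → Continuous u₀ → (∀ x, 0 < a₀ x) → (∀ x, 0 < θ₀ x) → ∃ σ₀ : ℝ, 0 < σ₀ ∧ ∀ σ : ℝ, 0 < σ → σ < σ₀ → ∀ Φ : (N : ℕ) → Literature.Analysis.FluidPDE.HardSphereFlow (Literature.Analysis.FluidPDE.Torus.geometry (Fin 3)) (Literature.MathematicalPhysics.KineticTheory.hsDiameter σ N) (N + 1), (∀ Δ : ℕ → ℝ, (∀ N, 0 < Δ N) → Tendsto Δ atTop (𝓝 0) → Tendsto (fun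 N : ℕ => Δ N * ((N + 1 : ℕ) : ℝ) ^ ((1 : ℝ) / 3)) atTop atTop → ∀ t : ℝ, 0 < t → Tendsto (fun N : ℕ => ∫⁻ z, ENNReal.ofReal (ipr σ N ((Φ N).flow (t - Δ N) z) (Δ N)) ∂(Literature.MathematicalPhysics.KineticTheory.localGibbsLaw σ a₀ u₀ θ₀ N (Φ N))) atTop (𝓝 0)) → (∀ t : ℝ, 0 < t → ∃ lam Cexp : ℝ, 0 < lam ∧ Tendsto (fun N : ℕ => Literature.MathematicalPhysics.KineticTheory.localGibbsLaw σ a₀ u₀ θ₀ N (Φ N) {z | Cexp < ∫ s in Icc 0 t, ∫ y, Real.exp (lam * ‖y.2‖ ^ 2) ∂(Literature.Analysis.FluidPDE.empiricalMeasure ((Φ N).flow s z))}) atTop (𝓝 0)) → ∀ (γ C : ℝ) (φ : ℕ → (UnitAddTorus (Fin 3)) → ℝ), 0 < γ → γ ≤ 1 / 15 → ((∀ N, Literature.Analysis.FunctionSpaces.Torus.IsSmooth (φ N)) ∧ (∀ N y, 0 ≤ φ N y) ∧ (∀ N, ∫ y, φ N y = 1) ∧ (∀ (N : ℕ) y, ((N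 : ℝ) + 1) ^ (-γ) ≤ Literature.Analysis.FluidPDE.Torus.euclidDist y 0 → φ N y = 0) ∧ (∀ (N : ℕ) y, φ N y ≤ C * ((N : ℝ) + 1) ^ (3 * γ)) ∧ (∀ (N : ℕ) y, ‖Literature.Analysis.FunctionSpaces.Torus.gradient (φ N) y‖ ≤ C * ((N : ℝ) + 1) ^ (4 * γ))) → let ρb := fun (N : ℕ) (s : ℝ) z (x : UnitAddTorus (Fin 3)) => Literature.MathematicalPhysics.KineticTheory.empiricalDensityField ((Φ N).flow s z) (fun y => φ N (y - x)); let mb := fun (N : ℕ) (s : ℝ) z (x : UnitAddTorus (Fin 3)) => Literature.MathematicalPhysics.KineticTheory.empiricalMomentumField ((Φ N).flow s z) (fun y => φ N (y - x)); let ub := fun (N : ℕ) (s : ℝ) z (x : UnitAddTorus (Fin 3)) => (ρb N s z x)⁻¹ • mb N s z x; let D := fun (N : ℕ) (s : ℝ) z (x : UnitAddTorus (Fin 3)) (j k : Fin 3) => (∫ y, φ N (y.1 - x) * ((y.2 j - ub N s z x j) * (y.2 k - ub N s z x k)) ∂(Literature.Analysis.FluidPDE.empiricalMeasure ((Φ N).flow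 s z))) - (if j = k then (∑ l : Fin 3, ∫ y, φ N (y.1 - x) * (y.2 l - ub N s z x l) ^ 2 ∂(Literature.Analysis.FluidPDE.empiricalMeasure ((Φ N).flow s z))) / 3 else 0); let q := fun (N : ℕ) (s : ℝ) z (x : UnitAddTorus (Fin 3)) => ∫ y, (φ N (y.1 - x) * ‖y.2 - ub N s z x‖ ^ 2 / 2) • (y.2 - ub N s z x) ∂(Literature.Analysis.FluidPDE.empiricalMeasure ((Φ N).flow s z)); ∀ t : ℝ, 0 < t → ∀ δ : ℝ, 0 < δ → Tendsto (fun N : ℕ => Literature.MathematicalPhysics.KineticTheory.localGibbsLaw σ a₀ u₀ θ₀ N (Φ N) {z | δ < ∫ s in Icc 0 t, ∫ x, ((∑ j, ∑ k, D N s z x j k ^ 2) + ‖q N s z x‖ ^ 2)}) atTop (𝓝 0)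

/-- rev 12 ⇒ rev 11 (pure logic: feed the global tail hypothesis at the horizon in hand). -/
theorem rev11_of_named (h : Named) : Rev11 := by
  intro a₀ θ₀ u₀ ha hθ hu ha0 hθ0
  obtain ⟨σ₀, hσ₀, H⟩ := h a₀ θ₀ u₀ ha hθ hu ha0 hθ0
  refine ⟨σ₀, hσ₀, fun σ hσ hσ' Φ h1 h2 γ C φ hγ hγ' hadm => ?_⟩
  intro ρb mb ub D q t ht δ hδ
  exact H σ hσ hσ' Φ h1 γ C φ hγ hγ' hadm t ht (h2 t ht) δ hδ

/-! ### §1b One hypothesis dropped (rev-12 shapes); the kinetic hinge 9522 still implies everything -/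

/-- The crux with H1 (diffuse rows) DROPPED: `∀ profiles ∃ σ₀ ∀ σ < σ₀ ∀ Φ, kernels → ∀ t > 0, H2(t) → C(t)`. -/
def WithoutDiffuse : Prop :=
  ∀ (a₀ θ₀ : (UnitAddTorus (Fin 3)) → ℝ) (u₀ : (UnitAddTorus (Fin 3)) → (EuclideanSpace ℝ (Fin 3))), Continuous a₀ → Continuous θ₀ → Continuous u₀ → (∀ x, 0 < a₀ x) → (∀ x, 0 < θ₀ x) → ∃ σ₀ : ℝ, 0 < σ₀ ∧ ∀ σ : ℝ, 0 < σ → σ < σ₀ → ∀ Φ : (N : ℕ) → Literature.Analysis.FluidPDE.HardSphereFlow (Literature.Analysis.FluidPDE.Torus.geometry (Fin 3)) (Literature.MathematicalPhysics.KineticTheory.hsDiameter σ N) (N + 1), ∀ (γ C : ℝ) (φ : ℕ → (UnitAddTorus (Fin 3)) → ℝ), 0 < γ → γ ≤ 1 / 15 → ((∀ N, Literature.Analysis.FunctionSpaces.Torus.IsSmooth (φ N)) ∧ (∀ N y, 0 ≤ φ N y) ∧ (∀ N, ∫ y, φ N y = 1) ∧ (∀ (N : ℕ) y, ((N : ℝ)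 + 1) ^ (-γ) ≤ Literature.Analysis.FluidPDE.Torus.euclidDist y 0 → φ N y = 0) ∧ (∀ (N : ℕ) y, φ N y ≤ C * ((N : ℝ) + 1) ^ (3 * γ)) ∧ (∀ (N : ℕ) y, ‖Literature.Analysis.FunctionSpaces.Torus.gradient (φ N) y‖ ≤ C * ((N : ℝ) + 1) ^ (4 * γ))) → let ρb := fun (N : ℕ) (s : ℝ) z (x : UnitAddTorus (Fin 3)) => Literature.MathematicalPhysics.KineticTheory.empiricalDensityField ((Φ N).flow s z) (fun y => φ N (y - x)); let mb := fun (N : ℕ) (s : ℝ) z (x : UnitAddTorus (Fin 3)) => Literature.MathematicalPhysics.KineticTheory.empiricalMomentumField ((Φ N).flow s z) (fun y => φ N (y - x)); let ub := fun (N : ℕ) (s : ℝ) z (x : UnitAddTorus (Fin 3)) => (ρb N s z x)⁻¹ • mb N s z x; let D := fun (N : ℕ) (s : ℝ) z (x : UnitAddTorus (Fin 3)) (j k : Fin 3) => (∫ y, φ N (y.1 - x) * ((y.2 j - ub N s z x j) * (y.2 k - ub N s z x k)) ∂(Literature.Analysis.FluidPDE.empiricalMeasure ((Φ N).flow s z)))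 - (if j = k then (∑ l : Fin 3, ∫ y, φ N (y.1 - x) * (y.2 l - ub N s z x l) ^ 2 ∂(Literature.Analysis.FluidPDE.empiricalMeasure ((Φ N).flow s z))) / 3 else 0); let q := fun (N : ℕ) (s : ℝ) z (x : UnitAddTorus (Fin 3)) => ∫ y, (φ N (y.1 - x) * ‖y.2 - ub N s z x‖ ^ 2 / 2) • (y.2 - ub N s z x) ∂(Literature.Analysis.FluidPDE.empiricalMeasure ((Φ N).flow s z)); ∀ t : ℝ, 0 < t → (∃ lam Cexp : ℝ, 0 < lam ∧ Tendsto (fun N : ℕ => Literature.MathematicalPhysics.KineticTheory.localGibbsLaw σ a₀ u₀ θ₀ N (Φ N) {z | Cexp < ∫ s in Icc 0 t, ∫ y, Real.exp (lam * ‖y.2‖ ^ 2) ∂(Literature.Analysis.FluidPDE.empiricalMeasure ((Φ N).flow s z))}) atTop (𝓝 0)) → ∀ δ : ℝ, 0 < δ → Tendsto (fun N : ℕ => Literature.MathematicalPhysics.KineticTheory.localGibbsLaw σ a₀ u₀ θ₀ N (Φ N) {z | δ < ∫ s in Icc 0 t, ∫ x, ((∑ j, ∑ k, D N s z x j k ^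 2) + ‖q N s z x‖ ^ 2)}) atTop (𝓝 0)

/-- The crux with H2 (time-averaged exponential velocity moment on `[0,t]`) DROPPED:
`∀ profiles ∃ σ₀ ∀ σ < σ₀ ∀ Φ, H1 → kernels → ∀ t > 0, C(t)`. -/
def WithoutTails : Prop :=
  ∀ (a₀ θ₀ : (UnitAddTorus (Fin 3)) → ℝ) (u₀ : (UnitAddTorus (Fin 3)) → (EuclideanSpace ℝ (Fin 3))), Continuous a₀ → Continuous θ₀ → Continuous u₀ → (∀ x, 0 < a₀ x) → (∀ x, 0 < θ₀ x) → ∃ σ₀ : ℝ, 0 < σ₀ ∧ ∀ σ : ℝ, 0 < σ → σ < σ₀ → ∀ Φ : (N : ℕ) → Literature.Analysis.FluidPDE.HardSphereFlow (Literature.Analysis.FluidPDE.Torus.geometry (Fin 3)) (Literature.MathematicalPhysics.KineticTheory.hsDiameter σ N) (N + 1), (∀ Δ : ℕ → ℝ, (∀ N, 0 < Δ N) → Tendsto Δ atTop (𝓝 0) → Tendsto (fun N : ℕ => Δ N * ((N + 1 : ℕ) : ℝ) ^ ((1 : ℝ) / 3)) atTop atTop → ∀ t : ℝ, 0 < t →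 Tendsto (fun N : ℕ => ∫⁻ z, ENNReal.ofReal (ipr σ N ((Φ N).flow (t - Δ N) z) (Δ N)) ∂(Literature.MathematicalPhysics.KineticTheory.localGibbsLaw σ a₀ u₀ θ₀ N (Φ N))) atTop (𝓝 0)) → ∀ (γ C : ℝ) (φ : ℕ → (UnitAddTorus (Fin 3)) → ℝ), 0 < γ → γ ≤ 1 / 15 → ((∀ N, Literature.Analysis.FunctionSpaces.Torus.IsSmooth (φ N)) ∧ (∀ N y, 0 ≤ φ N y) ∧ (∀ N, ∫ y, φ N y = 1) ∧ (∀ (N : ℕ) y, ((N : ℝ) + 1) ^ (-γ) ≤ Literature.Analysis.FluidPDE.Torus.euclidDist y 0 → φ N y = 0) ∧ (∀ (N : ℕ) y, φ N y ≤ C * ((N : ℝ) + 1) ^ (3 * γ)) ∧ (∀ (N : ℕ) y, ‖Literature.Analysis.FunctionSpaces.Torus.gradient (φ N) y‖ ≤ C * ((N : ℝ) + 1) ^ (4 * γ))) → let ρb := fun (N : ℕ) (s : ℝ) z (x : UnitAddTorus (Fin 3)) => Literature.MathematicalPhysics.KineticTheory.empiricalDensityField ((Φ N).flow s z) (fun y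 => φ N (y - x)); let mb := fun (N : ℕ) (s : ℝ) z (x : UnitAddTorus (Fin 3)) => Literature.MathematicalPhysics.KineticTheory.empiricalMomentumField ((Φ N).flow s z) (fun y => φ N (y - x)); let ub := fun (N : ℕ) (s : ℝ) z (x : UnitAddTorus (Fin 3)) => (ρb N s z x)⁻¹ • mb N s z x; let D := fun (N : ℕ) (s : ℝ) z (x : UnitAddTorus (Fin 3)) (j k : Fin 3) => (∫ y, φ N (y.1 - x) * ((y.2 j - ub N s z x j) * (y.2 k - ub N s z x k)) ∂(Literature.Analysis.FluidPDE.empiricalMeasure ((Φ N).flow s z))) - (if j = k then (∑ l : Fin 3, ∫ y, φ N (y.1 - x) * (y.2 l - ub N s z x l) ^ 2 ∂(Literature.Analysis.FluidPDE.empiricalMeasure ((Φ N).flow s z))) / 3 else 0); let q := fun (N : ℕ) (s : ℝ) z (x : UnitAddTorus (Fin 3)) => ∫ y, (φ N (y.1 - x) * ‖y.2 - ub N s z x‖ ^ 2 / 2) • (y.2 - ub N s z x) ∂(Literature.Analysis.FluidPDE.empiricalMeasure ((Φ N).flow s z)); ∀ t : ℝ, 0 < t → ∀ δ : ℝ, 0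 < δ → Tendsto (fun N : ℕ => Literature.MathematicalPhysics.KineticTheory.localGibbsLaw σ a₀ u₀ θ₀ N (Φ N) {z | δ < ∫ s in Icc 0 t, ∫ x, ((∑ j, ∑ k, D N s z x j k ^ 2) + ‖q N s z x‖ ^ 2)}) atTop (𝓝 0)

/-- Both hypotheses dropped: `∀ profiles ∃ σ₀ ∀ σ < σ₀ ∀ Φ, kernels → ∀ t > 0, C(t)` — the UNCONDITIONAL kinetic
hinge, i.e. route `StiffCollisionalRelaxation`'s crux `FastMomentRelaxation` (stmt-9522) verbatim up to ζ-reduction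
(checked below by `Iff.rfl`).  Since rev 12 THIS route's target is the weaker, Euler-conditioned
`FastMomentRelaxationPreShock`, which does NOT imply the crux any more (§1c). -/
def KineticClosure : Prop :=
  ∀ (a₀ θ₀ : (UnitAddTorus (Fin 3)) → ℝ) (u₀ : (UnitAddTorus (Fin 3)) → (EuclideanSpace ℝ (Fin 3))), Continuous a₀ → Continuous θ₀ → Continuous u₀ → (∀ x, 0 < a₀ x) → (∀ x, 0 < θ₀ x) → ∃ σ₀ : ℝ, 0 < σ₀ ∧ ∀ σ : ℝ, 0 < σ → σ < σ₀ → ∀ Φ : (N : ℕ) → Literature.Analysis.FluidPDE.HardSphereFlow (Literature.Analysis.FluidPDE.Torus.geometry (Fin 3)) (Literature.MathematicalPhysics.KineticTheory.hsDiameter σ N) (N + 1), ∀ (γ C : ℝ) (φ : ℕ → (UnitAddTorus (Fin 3)) → ℝ), 0 < γ → γ ≤ 1 / 15 → ((∀ N, Literature.Analysis.FunctionSpaces.Torus.IsSmooth (φ N)) ∧ (∀ N y, 0 ≤ φ N y) ∧ (∀ N, ∫ y, φ N y = 1) ∧ (∀ (N : ℕ) y, ((N : ℝ) + 1) ^ (-γ)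 ≤ Literature.Analysis.FluidPDE.Torus.euclidDist y 0 → φ N y = 0) ∧ (∀ (N : ℕ) y, φ N y ≤ C * ((N : ℝ) + 1) ^ (3 * γ)) ∧ (∀ (N : ℕ) y, ‖Literature.Analysis.FunctionSpaces.Torus.gradient (φ N) y‖ ≤ C * ((N : ℝ) + 1) ^ (4 * γ))) → let ρb := fun (N : ℕ) (s : ℝ) z (x : UnitAddTorus (Fin 3)) => Literature.MathematicalPhysics.KineticTheory.empiricalDensityField ((Φ N).flow s z) (fun y => φ N (y - x)); let mb := fun (N : ℕ) (s : ℝ) z (x : UnitAddTorus (Fin 3)) => Literature.MathematicalPhysics.KineticTheory.empiricalMomentumField ((Φ N).flow s z) (fun y => φ N (y - x)); let ub := fun (N : ℕ) (s : ℝ) z (x : UnitAddTorus (Fin 3)) => (ρb N s z x)⁻¹ • mb N s z x; let D := fun (N : ℕ) (s : ℝ) z (x : UnitAddTorus (Fin 3)) (j k : Fin 3) => (∫ y, φ N (y.1 - x) * ((y.2 j - ub N s z x j) * (y.2 k - ub N s z x k)) ∂(Literature.Analysis.FluidPDE.empiricalMeasure ((Φ N).flow s z))) - (if j = k then (∑ l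 : Fin 3, ∫ y, φ N (y.1 - x) * (y.2 l - ub N s z x l) ^ 2 ∂(Literature.Analysis.FluidPDE.empiricalMeasure ((Φ N).flow s z))) / 3 else 0); let q := fun (N : ℕ) (s : ℝ) z (x : UnitAddTorus (Fin 3)) => ∫ y, (φ N (y.1 - x) * ‖y.2 - ub N s z x‖ ^ 2 / 2) • (y.2 - ub N s z x) ∂(Literature.Analysis.FluidPDE.empiricalMeasure ((Φ N).flow s z)); ∀ t : ℝ, 0 < t → ∀ δ : ℝ, 0 < δ → Tendsto (fun N : ℕ => Literature.MathematicalPhysics.KineticTheory.localGibbsLaw σ a₀ u₀ θ₀ N (Φ N) {z | δ < ∫ s in Icc 0 t, ∫ x, ((∑ j, ∑ k, D N s z x j k ^ 2) + ‖q N s z x‖ ^ 2)}) atTop (𝓝 0)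

/-- `KineticClosure` is stmt-9522 (`StiffCollisionalRelaxation.FastMomentRelaxation`), definitionally. -/
theorem kineticClosure_iff_fmr9522 :
    KineticClosure ↔ Summit.AtomisticToContinuum.HydrodynamicLimit.Theses.StiffCollisionalRelaxation.FastMomentRelaxation :=
  Iff.rfl

/-- Dropping H1 only strengthens the crux (pure logic). -/
theorem named_of_withoutDiffuse (h : WithoutDiffuse) : Named := by
  intro a₀ θ₀ u₀ ha hθ hu ha0 hθ0
  obtain ⟨σ₀, hσ₀, H⟩ := h a₀ θ₀ u₀ ha hθ hu ha0 hθ0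
  exact ⟨σ₀, hσ₀, fun σ hσ hσ' Φ _ => H σ hσ hσ' Φ⟩

/-- Dropping H2 only strengthens the crux (pure logic). -/
theorem named_of_withoutTails (h : WithoutTails) : Named := by
  intro a₀ θ₀ u₀ ha hθ hu ha0 hθ0
  obtain ⟨σ₀, hσ₀, H⟩ := h a₀ θ₀ u₀ ha hθ hu ha0 hθ0
  refine ⟨σ₀, hσ₀, fun σ hσ hσ' Φ h1 γ C φ hγ hγ' hadm => ?_⟩
  intro ρb mb ub D q t ht _ δ hδ
  exact H σ hσ hσ' Φ h1 γ C φ hγ hγ' hadm t ht δ hδ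

/-- KEY STRUCTURAL FACT (survives rev 12), H1 half: the unconditional hinge 9522 implies the crux-without-H1.
Hence `¬ WithoutDiffuse → ¬ FastMomentRelaxation(9522)`: no `_false_without_Diffuse` certificate exists unless the
shared kinetic hinge is false. -/
theorem withoutDiffuse_of_kineticClosure (h : KineticClosure) : WithoutDiffuse := by
  intro a₀ θ₀ u₀ ha hθ hu ha0 hθ0
  obtain ⟨σ₀, hσ₀, H⟩ := h a₀ θ₀ u₀ ha hθ hu ha0 hθ0
  refine ⟨σ₀, hσ₀, fun σ hσ hσ' Φ γ C φ hγ hγ' hadm => ?_⟩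
  intro ρb mb ub D q t ht _ δ hδ
  exact H σ hσ hσ' Φ γ C φ hγ hγ' hadm t ht δ hδ

/-- KEY STRUCTURAL FACT, H2 half: 9522 implies the crux-without-H2. -/
theorem withoutTails_of_kineticClosure (h : KineticClosure) : WithoutTails := by
  intro a₀ θ₀ u₀ ha hθ hu ha0 hθ0
  obtain ⟨σ₀, hσ₀, H⟩ := h a₀ θ₀ u₀ ha hθ hu ha0 hθ0
  exact ⟨σ₀, hσ₀, fun σ hσ hσ' Φ _ => H σ hσ hσ' Φ⟩

/-- Contrapositive packaging: any refutation of a hypothesis-dropped variant refutes stmt-9522. -/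
theorem not_fmr9522_of_not_without (h : ¬ WithoutDiffuse ∨ ¬ WithoutTails) :
    ¬ Summit.AtomisticToContinuum.HydrodynamicLimit.Theses.StiffCollisionalRelaxation.FastMomentRelaxation :=
  fun hF => h.elim (fun h1 => h1 (withoutDiffuse_of_kineticClosure (kineticClosure_iff_fmr9522.2 hF)))
    (fun h2 => h2 (withoutTails_of_kineticClosure (kineticClosure_iff_fmr9522.2 hF)))

/-- The crux from stmt-9522 (re-proof of the rattack seat's `awclt_of_fmr9522`, through the named form):
a refutation of the crux would refute the shared kinetic hinge of route `StiffCollisionalRelaxation`. -/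
theorem adaptedWeightCLT_of_fmr9522
    (h : Summit.AtomisticToContinuum.HydrodynamicLimit.Theses.StiffCollisionalRelaxation.FastMomentRelaxation) :
    AdaptedWeightCLT :=
  adaptedWeightCLT_iff_named.2
    (named_of_withoutDiffuse (withoutDiffuse_of_kineticClosure (kineticClosure_iff_fmr9522.2 h)))

/-! ### §1c What the route actually consumes: the PRE-SHOCK form `PreShock` (the prepared repair `C′`)

Since rev 12 the deciding theorem `closes` feeds the crux, at each `(σ, Φ)`, ONLY at horizons `0 < t < T` of a
classical hs-Euler solution with LLN-matching local Gibbs data and inside the dilute chamber `2ρσ³ < η₁` (that is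
where its H2 input, component (i) of `AprioriBoundsPreShock`, lives).  The crux itself is claimed for ALL `t > 0`
and all flows, with no Euler data — strictly more than the route uses.  `PreShock` below is the crux CONDITIONED
EXACTLY LIKE THE TARGET; `preShock_of_named` (crux ⇒ C′) and `fmrPreShock_of_preShock` /
`hydrodynamicLimit_of_preShock` (C′ suffices for `KineticEngineGlue`, `Assembly` and `closes`) are checked.
CONSEQUENCE FOR CLASSIFICATION: a counterexample to the crux living at `t ≥ T` (post-shock: sub-block shear /
Kelvin–Helmholtz roll-up of slip surfaces down to the inviscid band `N^{-1/6} ≪ ℓ ≪ N^{-γ}`, the one physical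
mechanism by which block kinetic stress can stay anisotropic in a collision-dominated gas — it is Reynolds stress
of unresolved sub-block flow, not a velocity-distribution effect) would be `refuted-misstated` with repaired
statement `C′ = PreShock`, and the route would survive the repair verbatim. -/

/-- `C′`: the crux conditioned like the target — Euler solution on `[0,T)`, LLN data, `0 < t < T`, dilute chamber
`2ρσ³ < η₁` (∃ η₁ after σ₀), H1 and the per-`t` H2 as in the crux. -/
def PreShock : Prop :=
  ∀ (a₀ θ₀ : (UnitAddTorus (Fin 3)) → ℝ) (u₀ : (UnitAddTorus (Fin 3)) → (EuclideanSpace ℝ (Fin 3))), Continuous a₀ → Continuous θ₀ → Continuous u₀ → (∀ x, 0 < a₀ x) → (∀ x, 0 < θ₀ x) → ∃ σ₀ : ℝ, 0 < σ₀ ∧ ∃ η₁ : ℝ, 0 < η₁ ∧ ∀ σ : ℝ, 0 < σ → σ < σ₀ → ∀ Φ : (N : ℕ) → Literature.Analysis.FluidPDE.HardSphereFlow (Literature.Analysis.FluidPDE.Torus.geometry (Fin 3)) (Literature.MathematicalPhysics.KineticTheory.hsDiameter σ N) (N + 1), (∀ Δ : ℕ → ℝ, (∀ N, 0 < Δ N)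 → Tendsto Δ atTop (𝓝 0) → Tendsto (fun N : ℕ => Δ N * ((N + 1 : ℕ) : ℝ) ^ ((1 : ℝ) / 3)) atTop atTop → ∀ t : ℝ, 0 < t → Tendsto (fun N : ℕ => ∫⁻ z, ENNReal.ofReal (ipr σ N ((Φ N).flow (t - Δ N) z) (Δ N)) ∂(Literature.MathematicalPhysics.KineticTheory.localGibbsLaw σ a₀ u₀ θ₀ N (Φ N))) atTop (𝓝 0)) → ∀ (T : ℝ) (ρ θ : ℝ → (UnitAddTorus (Fin 3)) → ℝ) (u : ℝ → (UnitAddTorus (Fin 3)) → (EuclideanSpace ℝ (Fin 3))), Literature.MathematicalPhysics.KineticTheory.IsHardSphereEulerSolution σ T ρ u θ → Literature.MathematicalPhysics.KineticTheory.TendstoHydroFieldsAt (fun N => Literature.MathematicalPhysics.KineticTheory.localGibbsLaw σ a₀ u₀ θ₀ N (Φ N)) Φ ρ u θ 0 → ∀ (γ C : ℝ) (φ : ℕ → (UnitAddTorus (Fin 3)) → ℝ), 0 < γ → γ ≤ 1 / 15 → ((∀ N, Literature.Analysis.FunctionSpaces.Torus.IsSmooth (φ N)) ∧ (∀ N y,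 0 ≤ φ N y) ∧ (∀ N, ∫ y, φ N y = 1) ∧ (∀ (N : ℕ) y, ((N : ℝ) + 1) ^ (-γ) ≤ Literature.Analysis.FluidPDE.Torus.euclidDist y 0 → φ N y = 0) ∧ (∀ (N : ℕ) y, φ N y ≤ C * ((N : ℝ) + 1) ^ (3 * γ)) ∧ (∀ (N : ℕ) y, ‖Literature.Analysis.FunctionSpaces.Torus.gradient (φ N) y‖ ≤ C * ((N : ℝ) + 1) ^ (4 * γ))) → let ρb := fun (N : ℕ) (s : ℝ) z (x : UnitAddTorus (Fin 3)) => Literature.MathematicalPhysics.KineticTheory.empiricalDensityField ((Φ N).flow s z) (fun y => φ N (y - x)); let mb := fun (N : ℕ) (s : ℝ) z (x : UnitAddTorus (Fin 3)) => Literature.MathematicalPhysics.KineticTheory.empiricalMomentumField ((Φ N).flow s z) (fun y => φ N (y - x)); let ub := fun (N : ℕ) (s : ℝ) z (x : UnitAddTorus (Fin 3)) => (ρb N s z x)⁻¹ • mb N s z x; let D := fun (N : ℕ) (s : ℝ) z (x : UnitAddTorus (Fin 3)) (j k : Fin 3) => (∫ y, φ N (y.1 - x) * ((y.2 j - ub N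 s z x j) * (y.2 k - ub N s z x k)) ∂(Literature.Analysis.FluidPDE.empiricalMeasure ((Φ N).flow s z))) - (if j = k then (∑ l : Fin 3, ∫ y, φ N (y.1 - x) * (y.2 l - ub N s z x l) ^ 2 ∂(Literature.Analysis.FluidPDE.empiricalMeasure ((Φ N).flow s z))) / 3 else 0); let q := fun (N : ℕ) (s : ℝ) z (x : UnitAddTorus (Fin 3)) => ∫ y, (φ N (y.1 - x) * ‖y.2 - ub N s z x‖ ^ 2 / 2) • (y.2 - ub N s z x) ∂(Literature.Analysis.FluidPDE.empiricalMeasure ((Φ N).flow s z)); ∀ t : ℝ, 0 < t → t < T → (∀ s ∈ Icc 0 t, ∀ x, 2 * ρ s x * σ ^ 3 < η₁) → (∃ lam Cexp : ℝ, 0 < lam ∧ Tendsto (fun N : ℕ => Literature.MathematicalPhysics.KineticTheory.localGibbsLaw σ a₀ u₀ θ₀ N (Φ N) {z | Cexp < ∫ s in Icc 0 t, ∫ y, Real.exp (lam * ‖y.2‖ ^ 2) ∂(Literature.Analysis.FluidPDE.empiricalMeasure ((Φ N).flow s z))}) atTop (𝓝 0)) → ∀ δ : ℝ, 0 < δ →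 Tendsto (fun N : ℕ => Literature.MathematicalPhysics.KineticTheory.localGibbsLaw σ a₀ u₀ θ₀ N (Φ N) {z | δ < ∫ s in Icc 0 t, ∫ x, ((∑ j, ∑ k, D N s z x j k ^ 2) + ‖q N s z x‖ ^ 2)}) atTop (𝓝 0)

/-- crux ⇒ C′ (pure logic; `η₁ := 1`, the Euler data and the chamber are ignored). -/
theorem preShock_of_named (h : Named) : PreShock := by
  intro a₀ θ₀ u₀ ha hθ hu ha0 hθ0
  obtain ⟨σ₀, hσ₀, H⟩ := h a₀ θ₀ u₀ ha hθ hu ha0 hθ0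
  refine ⟨σ₀, hσ₀, 1, one_pos, fun σ hσ hσ' Φ h1 T ρ θ u _ _ γ C φ hγ hγ' hadm => ?_⟩
  intro ρb mb ub D q t ht _ _ h2 δ hδ
  exact H σ hσ hσ' Φ h1 γ C φ hγ hγ' hadm t ht h2 δ hδ

/-- C′ suffices for the kinetic engine glue: `DiffuseBackwardInfluence → PreShock → AprioriBoundsPreShock →
FastMomentRelaxationPreShock` (the inline block of `closes`, re-run with `PreShock` in place of the crux;
`σ₀ := min σ₁ (min σ₂ σ₃)`, `η₁ := min η₂ η₃`). -/
theorem fmrPreShock_of_preShock (hD : DiffuseBackwardInfluence) (hC : PreShock) (h₃ : AprioriBoundsPreShock) :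
    FastMomentRelaxationPreShock := by
  intro a₀ θ₀ u₀ ha hθ hu hapos hθpos
  obtain ⟨σ₁, hσ₁, H1⟩ := hD a₀ θ₀ u₀ ha hθ hu hapos hθpos
  obtain ⟨σ₂, hσ₂, η₂, hη₂, H2⟩ := hC a₀ θ₀ u₀ ha hθ hu hapos hθpos
  obtain ⟨σ₃, hσ₃, η₃, hη₃, H3⟩ := h₃ a₀ θ₀ u₀ ha hθ hu hapos hθpos
  refine ⟨min σ₁ (min σ₂ σ₃), lt_min hσ₁ (lt_min hσ₂ hσ₃), min η₂ η₃, lt_min hη₂ hη₃, ?_⟩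
  intro σ hσ hσlt T ρ θ u hsol Φ hLLN
  have h1 := H1 σ hσ (lt_of_lt_of_le hσlt (min_le_left _ _))
  have h2 := H2 σ hσ (lt_of_lt_of_le hσlt ((min_le_right _ _).trans (min_le_left _ _)))
  have h3 := H3 σ hσ (lt_of_lt_of_le hσlt ((min_le_right _ _).trans (min_le_right _ _))) T ρ θ u hsol Φ hLLN
  intro γ C φ hγ hγ' hadm ρb mb ub D q t ht htT hdil δ hδ
  have hdil₂ : ∀ s ∈ Icc 0 t, ∀ x, 2 * ρ s x * σ ^ 3 < η₂ :=
    fun s hs x => lt_of_lt_of_le (hdil s hs x) (min_le_left _ _)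
  have hdil₃ : ∀ s ∈ Icc 0 t, ∀ x, 2 * ρ s x * σ ^ 3 < η₃ :=
    fun s hs x => lt_of_lt_of_le (hdil s hs x) (min_le_right _ _)
  exact h2 Φ (h1 Φ) T ρ θ u hsol hLLN γ C φ hγ hγ' hadm t ht htT hdil₂ (h3 t ht htT hdil₃).1 δ hδ

/-- C′ suffices for the whole route: `closes` re-run with `PreShock` in place of the crux. -/
theorem hydrodynamicLimit_of_preShock (hD : DiffuseBackwardInfluence) (hC : PreShock)
    (h₃ : AprioriBoundsPreShock) (h₂ : CollisionalTransferLocality) (hM : MacroClosure) :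
    _root_.HydrodynamicLimit :=
  hM h₂ h₃ (fmrPreShock_of_preShock hD hC h₃)

/-- Packaging for the planner: if the crux fails but its pre-shock conditioning `C′` holds, nothing in the
route is lost (`Assembly` with `PreShock` for `AdaptedWeightCLT`). -/
theorem assembly_with_preShock :
    DiffuseBackwardInfluence → PreShock → AprioriBoundsPreShock → CollisionalTransferLocality → MacroClosure →
      _root_.HydrodynamicLimit :=
  hydrodynamicLimit_of_preShock

/-! ## §2 Tightness: collision-free windows, the ceiling `9` and the floor `9/n` -/

/-- With no collision in the window the transfer is the identity (the fold runs over `List.range 0`). -/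
theorem transfer_of_collisionCount_eq_zero {σ : ℝ} {N : ℕ} {y : Config (N + 1) (Fin 3) T3} {Δ : ℝ}
    (h : Alexander.collisionCount (Torus.geometry (Fin 3)) (hsDiameter σ N) y Δ = 0)
    (W : Fin (N + 1) → V3) : transfer σ N y Δ W = W := by
  simp only [transfer, h, List.range_zero, List.foldl_nil]

/-- Row weights of the identity transfer: `∑ₐ ‖(e_k ⊗ e_a)_i‖² = 3·[i = k]`. -/
theorem identity_row_weight (N : ℕ) (i k : Fin (N + 1)) :
    (∑ a : Fin 3, ‖(Pi.single k (EuclideanSpace.single a (1 : ℝ)) : Fin (N + 1) → V3) i‖ ^ 2)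
      = if i = k then 3 else 0 := by
  by_cases h : i = k
  · subst h
    simp
  · simp [h]

/-- The ipr functional of the identity transfer is exactly `9` — the ceiling of `ipr ∈ [9/(N+1), 9]`
is attained on every collision-free window, so H1 (`E ipr → 0`) forces collisions for all but `o(N)`
particles in every admissible window: any use of H1 is a use of collisions. -/
theorem ipr_identity (N : ℕ) :
    ((N + 1 : ℕ) : ℝ)⁻¹ * ∑ i : Fin (N + 1), ∑ k : Fin (N + 1),
      (∑ a : Fin 3, ‖(Pi.single k (EuclideanSpace.single a (1 : ℝ)) : Fin (N + 1) → V3) i‖ ^ 2) ^ 2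
      = 9 := by
  simp_rw [identity_row_weight]
  have h : ∀ i : Fin (N + 1), ∑ k : Fin (N + 1), ((if i = k then (3 : ℝ) else 0) ^ 2) = 9 := by
    intro i
    rw [Finset.sum_eq_single i]
    · norm_num
    · intro b _ hb
      simp [Ne.symm hb]
    · simp
  simp_rw [h]
  simp [Finset.sum_const, Finset.card_univ]
  field_simp

/-- Hence `ipr = 9` on collision-free windows of the actual typed transfer. -/
theorem ipr_of_collisionCount_eq_zero {σ : ℝ} {N : ℕ} {y : Config (N + 1) (Fin 3) T3} {Δ : ℝ}
    (h : Alexander.collisionCount (Torus.geometry (Fin 3)) (hsDiameter σ N) y Δ = 0) :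
    ipr σ N y Δ = 9 := by
  simp only [ipr, transfer_of_collisionCount_eq_zero h]
  exact ipr_identity N

/-- The floor: a row whose Frobenius budget `∑ₖ xₖ = 3` (`TransferIsometry`) is spread over `n`
ancestors has `∑ₖ xₖ² ≥ 9/n` (Cauchy–Schwarz), with equality iff all `xₖ = 3/n`; so `ipr → 0`
needs the number of ancestors carrying the weight to diverge — nothing less, nothing more. -/
theorem row_ipr_floor {n : ℕ} (hn : 0 < n) (x : Fin n → ℝ) (hx : ∑ k, x k = 3) :
    9 / n ≤ ∑ k, x k ^ 2 := by
  have hn' : (0 : ℝ) < n := by exact_mod_cast hn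
  have hcs := Finset.sum_mul_sq_le_sq_mul_sq (Finset.univ : Finset (Fin n)) x (fun _ => (1 : ℝ))
  simp only [mul_one, one_pow, Finset.sum_const, Finset.card_univ, Fintype.card_fin, nsmul_eq_mul,
    hx] at hcs
  rw [div_le_iff₀ hn']
  linarith

/-! ## §3 Natural strengthenings of the MECHANISM refuted in the smallest models

Two abstract claims a prover might hope to use, both false:
(S1) "a Lindeberg-normalised block row with `ipr → 0` isotropises the transported covariance";
(S2) "a unit row with minimal participation ratio, even if chosen adapted to the summands, has an
      approximately centred Gaussian output";
and two exact facts about the reflection step that say where isotropy can and cannot come from: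
(S3) normals orthogonal to a fixed direction freeze that velocity component (and violate H1);
(S4) a single reflection turns two isotropic covariances `θᵢ I`, `θⱼ I` into `θᵢ I + (θⱼ-θᵢ) ωωᵀ`.
-/

/-- `n` equal isotropic blocks `B = n^{-1/2} I₃`. -/
def isoBlock (n : ℕ) : Matrix (Fin 3) (Fin 3) ℝ := (Real.sqrt n)⁻¹ • (1 : Matrix (Fin 3) (Fin 3) ℝ)

/-- Every covariance passes through the isotropic diffuse row unchanged: `∑ₖ B S Bᵀ = S`. -/
theorem isoBlock_cov {n : ℕ} (hn : 0 < n) (S : Matrix (Fin 3) (Fin 3) ℝ) :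
    ∑ _k : Fin n, isoBlock n * S * (isoBlock n)ᵀ = S := by
  have hn' : (0 : ℝ) < n := by exact_mod_cast hn
  have hc : ((Real.sqrt n)⁻¹ * (Real.sqrt n)⁻¹ : ℝ) = (n : ℝ)⁻¹ := by
    rw [← mul_inv, Real.mul_self_sqrt hn'.le]
  simp only [isoBlock, Matrix.transpose_smul, Matrix.transpose_one, Matrix.smul_mul, Matrix.mul_smul,
    Matrix.mul_one, Matrix.one_mul, smul_smul, hc, Finset.sum_const, Finset.card_univ, Fintype.card_fin]
  rw [← Nat.cast_smul_eq_nsmul ℝ, smul_smul, mul_inv_cancel₀ hn'.ne', one_smul]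

/-- Lindeberg (row-isometry) normalisation of the isotropic diffuse row: `∑ₖ B Bᵀ = I₃`. -/
theorem isoBlock_lindeberg {n : ℕ} (hn : 0 < n) :
    ∑ _k : Fin n, isoBlock n * (isoBlock n)ᵀ = 1 := by
  simpa only [Matrix.mul_one] using isoBlock_cov hn 1

/-- Frobenius weight of one block: `‖B‖_F² = 3/n`. -/
theorem isoBlock_frob {n : ℕ} (hn : 0 < n) :
    ∑ a : Fin 3, ∑ b : Fin 3, (isoBlock n a b) ^ 2 = 3 / n := by
  have hn' : (0 : ℝ) < n := by exact_mod_cast hn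
  simp [isoBlock, Matrix.one_apply, Finset.sum_ite_eq, inv_pow, Real.sq_sqrt hn'.le]
  ring

/-- The row's ipr is the floor `9/n`. -/
theorem isoBlock_ipr {n : ℕ} (hn : 0 < n) :
    ∑ _k : Fin n, (∑ a : Fin 3, ∑ b : Fin 3, (isoBlock n a b) ^ 2) ^ 2 = 9 / n := by
  have hn' : (0 : ℝ) < n := by exact_mod_cast hn
  rw [isoBlock_frob hn]
  simp [Finset.sum_const, Finset.card_univ]
  field_simp
  ring

/-- ¬(S1): for every `n ≥ 1` there is a Lindeberg-normalised row of `n` blocks with the minimal ipr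
`9/n` that fixes EVERY covariance `S` — in particular a traceless (anisotropic) one.  So "mean ipr → 0"
(H1) plus the exact `ℓ²` budget cannot by themselves produce isotropy of the block kinetic stress: the
proof must extract ROTATIONAL mixing of the reflection products (or bootstrap isotropy from the
earlier time) from the dynamics.  (The blocks here are not reflection-generated; within
reflection-generated transfers a common invariant direction of all normals pins self-weight `≥ 1` and
violates H1 instead — see the rattack note on the item.) -/
theorem diffuse_rows_need_not_isotropise (n : ℕ) (hn : 0 < n) :
    ∃ B : Fin n → Matrix (Fin 3) (Fin 3) ℝ,
      (∑ k, B k * (B k)ᵀ = 1) ∧ (∑ k, (∑ a : Fin 3, ∑ b : Fin 3, (B k a b) ^ 2) ^ 2 = 9 / n) ∧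
      ∀ S : Matrix (Fin 3) (Fin 3) ℝ, ∑ k, B k * S * (B k)ᵀ = S :=
  ⟨fun _ => isoBlock n, isoBlock_lindeberg hn, isoBlock_ipr hn, isoBlock_cov hn⟩

/-- A two-valued sign (`+1` at `0`, so that the adapted row is always a unit vector). -/
def sgn (x : ℝ) : ℝ := if 0 ≤ x then 1 else -1

theorem sgn_mul_self (x : ℝ) : sgn x * x = |x| := by
  unfold sgn; split_ifs with h
  · rw [one_mul, abs_of_nonneg h]
  · rw [abs_of_neg (lt_of_not_ge h)]; ring

theorem sgn_sq (x : ℝ) : sgn x ^ 2 = 1 := by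
  unfold sgn; split_ifs <;> norm_num

/-- The sign-adapted unit row `rₖ(w) = sgn(wₖ)/√n`. -/
def adaptedRow (n : ℕ) (w : Fin n → ℝ) (k : Fin n) : ℝ := sgn (w k) / Real.sqrt n

theorem adaptedRow_unit {n : ℕ} (hn : 0 < n) (w : Fin n → ℝ) : ∑ k, adaptedRow n w k ^ 2 = 1 := by
  have hn' : (0 : ℝ) < n := by exact_mod_cast hn
  simp [adaptedRow, div_pow, sgn_sq, Real.sq_sqrt hn'.le, Finset.sum_const, Finset.card_univ]
  field_simp

theorem adaptedRow_ipr {n : ℕ} (hn : 0 < n) (w : Fin n → ℝ) : ∑ k, adaptedRow n w k ^ 4 = 1 / n := by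
  have hn' : (0 : ℝ) < n := by exact_mod_cast hn
  have h4 : ∀ x : ℝ, sgn x ^ 4 = 1 := fun x => by
    rw [show (4 : ℕ) = 2 * 2 from rfl, pow_mul, sgn_sq, one_pow]
  have hs : Real.sqrt (n : ℝ) ^ 4 = (n : ℝ) ^ 2 := by
    rw [show (4 : ℕ) = 2 * 2 from rfl, pow_mul, Real.sq_sqrt hn'.le]
  simp [adaptedRow, div_pow, h4, hs, Finset.sum_const, Finset.card_univ]
  field_simp

theorem adaptedRow_output (n : ℕ) (w : Fin n → ℝ) :
    ∑ k, adaptedRow n w k * w k = (∑ k, |w k|) / Real.sqrt n := by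
  simp only [adaptedRow, div_mul_eq_mul_div, sgn_mul_self, Finset.sum_div]

/-- ¬(S2): for every `n ≥ 1` there is an ADAPTED choice `w ↦ r(w)` of a unit row with the minimal
participation ratio `∑ rₖ⁴ = 1/n` whose output `∑ rₖ wₖ = ‖w‖₁/√n` is non-negative for every input —
for i.i.d. centred `wₖ` with `E|w₁| = m` its mean is `m√n → ∞`: no centring, no tightness, no CLT.
Diffuseness + isometry + adaptedness prove nothing; the conditional-Lindeberg step of the card needs
an input saying that the hard-sphere forest selects its summands only through the flux factor
`|g·ω|` acting on PAIRS under a chaotic law (the "chaos in CLT clothing" of the planner's warning),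
which neither H1 nor H2 provides. -/
theorem adapted_unit_rows_need_not_centre (n : ℕ) (hn : 0 < n) :
    ∃ r : (Fin n → ℝ) → (Fin n → ℝ),
      (∀ w, ∑ k, r w k ^ 2 = 1) ∧ (∀ w, ∑ k, r w k ^ 4 = 1 / n) ∧
      (∀ w, ∑ k, r w k * w k = (∑ k, |w k|) / Real.sqrt n) ∧ (∀ w, 0 ≤ ∑ k, r w k * w k) :=
  ⟨adaptedRow n, adaptedRow_unit hn, adaptedRow_ipr hn, adaptedRow_output n, fun w => by
    rw [adaptedRow_output]
    exact div_nonneg (Finset.sum_nonneg fun k _ => abs_nonneg _) (Real.sqrt_nonneg _)⟩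

/-- (S3) Planar / co-planar normals: a velocity field along a direction `e ⊥ n` is untouched by the
reflection `reflectVel n` (the fold step of the typed transfer).  If every collision normal of a window is
orthogonal to a fixed `e`, the `e`-components of all velocities are frozen, the self-block keeps
`‖M_ii e‖ = 1`, so `ipr ≥ 1`: the degenerate dynamics in which an anisotropy `T_ee ≠ T_⊥` persists
forever are exactly dynamics violating H1 — within reflection-generated transfers H1 does carry SOME
rotational information (contrast ¬(S1), whose blocks are not reflection-generated).  What it does not
carry is a RATE: see `one_reflection_covariance`. -/
theorem reflectVel_of_inner_eq_zero (n e : V3) (h : ⟪e, n⟫_ℝ = 0) (c₁ c₂ : ℝ) :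
    reflectVel n (c₁ • e, c₂ • e) = (c₁ • e, c₂ • e) := by
  have : ⟪c₁ • e - c₂ • e, n⟫_ℝ = 0 := by
    rw [← sub_smul, inner_smul_left, h]; simp
  simp [reflectVel, this]

/-- (S4) One adapted step TRANSPORTS a temperature difference into a rank-one anisotropy: if particle `i`
(isotropic covariance `θᵢ I`) collides with an independent partner `j` (covariance `θⱼ I`) at normal
projection `P = ωωᵀ` (`P² = P = Pᵀ`), the post-collisional covariance of `vᵢ` is
`(I-P) θᵢ (I-P)ᵀ + P θⱼ Pᵀ = θᵢ I + (θⱼ - θᵢ) P` — anisotropic whenever `θⱼ ≠ θᵢ`.  Isotropy of the CLT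
covariance `∑ₖ M_ik Σₖ M_ikᵀ` is therefore NOT a consequence of the Lindeberg normalisation once the
ancestors' temperatures differ: it needs the normals to be spread over the sphere faster than the
ancestors' temperatures spread (rotational diffuseness × cluster localisation, inputs (I1) and (I3)).
With isotropic independent normals the traceless part contracts by `7/15` (self) and enters with `2/15`
(partner) per collision — the rate a `RotationalDiffuseness` child would have to certify for the REALISED
normals. -/
theorem one_reflection_covariance (P : Matrix (Fin 3) (Fin 3) ℝ) (hP : P * P = P) (hPt : Pᵀ = P)
    (θi θj : ℝ) :
    (1 - P) * (θi • (1 : Matrix (Fin 3) (Fin 3) ℝ)) * (1 - P)ᵀ +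
        P * (θj • (1 : Matrix (Fin 3) (Fin 3) ℝ)) * Pᵀ
      = θi • (1 : Matrix (Fin 3) (Fin 3) ℝ) + (θj - θi) • P := by
  rw [Matrix.transpose_sub, Matrix.transpose_one, hPt]
  simp only [Matrix.mul_smul, Matrix.smul_mul, sub_mul, mul_sub, one_mul, mul_one, hP,
    sub_self, sub_zero]
  rw [sub_smul]
  abel

/-! ## §4 Small model: the exact weight split of ONE reflection (`collidePair` = `reflectVel` at the
separation vector) — the planner's "9 → 5" is exact for every non-zero normal -/

theorem sum_sq_apply (n : V3) : ∑ a : Fin 3, (n a) ^ 2 = ‖n‖ ^ 2 := by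
  rw [EuclideanSpace.norm_eq, Real.sq_sqrt (Finset.sum_nonneg fun _ _ => by positivity)]
  simp [Real.norm_eq_abs, sq_abs]

theorem inner_single_one_left (a : Fin 3) (n : V3) :
    ⟪(EuclideanSpace.single a (1 : ℝ) : V3), n⟫_ℝ = n a := by
  simp [EuclideanSpace.inner_single_left]

/-- After one reflection of the pair `(i, j)` with (unnormalised) normal `n ≠ 0`, the weight that row
`i` puts on its PARTNER's fresh velocity is exactly `1` (the `ωωᵀ` block). -/
theorem partner_weight_after_reflection (n : V3) (hn : n ≠ 0) :
    ∑ a : Fin 3, ‖(reflectVel n ((0 : V3), (EuclideanSpace.single a (1 : ℝ) : V3))).1‖ ^ 2 = 1 := by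
  have hn' : ‖n‖ ≠ 0 := norm_ne_zero_iff.2 hn
  have key : ∀ a : Fin 3, ‖(reflectVel n ((0 : V3), (EuclideanSpace.single a (1 : ℝ) : V3))).1‖ ^ 2
      = (n a) ^ 2 / ‖n‖ ^ 2 := by
    intro a
    simp only [reflectVel, zero_sub, inner_neg_left, inner_single_one_left, neg_div, neg_smul,
      sub_neg_eq_add, zero_add, norm_smul, Real.norm_eq_abs, mul_pow, sq_abs]
    field_simp
  simp_rw [key, ← Finset.sum_div, sum_sq_apply]
  field_simp

/-- … and the weight it keeps on ITSELF is exactly `2` (the `I - ωωᵀ` block): the fresh row budget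
`3` splits `2 + 1`, so its ipr drops from `3² = 9` to `2² + 1² = 5`, whatever the normal. -/
theorem self_weight_after_reflection (n : V3) (hn : n ≠ 0) :
    ∑ a : Fin 3, ‖(reflectVel n ((EuclideanSpace.single a (1 : ℝ) : V3), (0 : V3))).1‖ ^ 2 = 2 := by
  have hn' : ‖n‖ ≠ 0 := norm_ne_zero_iff.2 hn
  have key : ∀ a : Fin 3, ‖(reflectVel n ((EuclideanSpace.single a (1 : ℝ) : V3), (0 : V3))).1‖ ^ 2
      = 1 - (n a) ^ 2 / ‖n‖ ^ 2 := by
    intro a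
    simp only [reflectVel, sub_zero, inner_single_one_left]
    rw [norm_sub_sq_real, inner_smul_right, inner_single_one_left, norm_smul, Real.norm_eq_abs,
      mul_pow, sq_abs]
    simp
    field_simp
    ring
  simp_rw [key, Finset.sum_sub_distrib, ← Finset.sum_div, sum_sq_apply]
  simp
  field_simp
  norm_num


/-! ## §5 Line `contact-source-duhamel` (lead prover-line-stmt-AtomisticToContinuum-14868-0; re-cut skeleton
`Lines/contact_source_duhamel.lean`, 7 stubs, 1–2 proved and landed, hardest `stub_contactCrossNull`)

Targets = the lead's stuck stubs: none filed (payload `stuck_stubs = []`).  Landed earlier for this line: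
`Theorems/AdaptedWeightCLT/Negative/CubicProbeDeficiency.lean` (p84881, cycle 2: the six `dirV` probes of the
rev-11 `cd3` lie on `xyz = 0`; repaired by the lead with `cd3x`).  This cycle adds two checked toys over the
LANDED line vocabulary `Theorems.ContactSourceDuhamel` (`mapT, projM, coprojM, projV, coprojV, tpow, crossT,
chaosCross`): §5a the cradle relay (cloud locality is not free — a gap in `stub_pastDamping`'s sketch), §5b the
closure-debt witness (CCN/SC are not consequences of C).
-/


/-! ### §5a Cloud mass travels through collision CHAINS, not with particles: the cradle relay (`stub_pastDamping`) -/

section Relay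

open Summit.AtomisticToContinuum.HydrodynamicLimit.Theorems.ContactSourceDuhamel hiding T3 V3

variable {r : ℕ}

/-- `M^{⊗r}` of a rank-one power is the power of the mapped vector (copy of the landed
`…StubDuhamel.mapT_tpow`, whose module imports the dead rev-11 Statements file). -/
theorem mapT_tpow_apply (M : Mat3) (a : V3) (idx : Fin r → Fin 3) :
    mapT M (tpow r a) idx = ∏ s, ∑ d, M (idx s) d * a d := by
  simp only [mapT, tpow]
  rw [Fintype.prod_sum]
  exact Finset.sum_congr rfl fun idx' _ => Finset.prod_mul_distrib.symm

theorem inner_eq_sum' (n a : V3) : ⟪n, a⟫_ℝ = ∑ d, n d * a d := by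
  simp only [PiLp.inner_apply, RCLike.inner_apply, conj_trivial]
  exact Finset.sum_congr rfl fun d _ => mul_comm _ _

theorem projM_mulVec' (n a : V3) (c : Fin 3) : ∑ d, projM n c d * a d = projV n a c := by
  simp only [projM, projV, PiLp.smul_apply, smul_eq_mul, inner_eq_sum']
  rw [Finset.sum_div, Finset.sum_mul]
  exact Finset.sum_congr rfl fun d _ => by ring

theorem coprojM_mulVec' (n a : V3) (c : Fin 3) : ∑ d, coprojM n c d * a d = coprojV n a c := by
  simp only [coprojM, coprojV, projV, sub_mul, Finset.sum_sub_distrib, ite_mul, one_mul, zero_mul,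
    Finset.sum_ite_eq, Finset.mem_univ, if_true, PiLp.sub_apply, PiLp.smul_apply, smul_eq_mul,
    inner_eq_sum']
  rw [Finset.sum_div, Finset.sum_mul]
  exact congrArg _ (Finset.sum_congr rfl fun d _ => by ring)

theorem mapT_projM_tpow' (n a : V3) : mapT (projM n) (tpow r a) = tpow r (projV n a) := by
  funext idx; rw [mapT_tpow_apply]; simp only [tpow, projM_mulVec']

theorem mapT_coprojM_tpow' (n a : V3) : mapT (coprojM n) (tpow r a) = tpow r (coprojV n a) := by
  funext idx; rw [mapT_tpow_apply]; simp only [tpow, coprojM_mulVec']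

/-- `mapT M 0 = 0`. -/
theorem mapT_zero (M : Mat3) : mapT M (0 : Tens r) = 0 := by
  funext idx; simp [mapT]

/-- `P n = n`. -/
theorem projV_self {n : V3} (hn : n ≠ 0) : projV n n = n := by
  have h : ‖n‖ ^ 2 ≠ 0 := pow_ne_zero 2 (norm_ne_zero_iff.2 hn)
  simp [projV, h]

/-- `Q n = 0`. -/
theorem coprojV_self {n : V3} (hn : n ≠ 0) : coprojV n n = 0 := by
  simp [coprojV, projV_self hn]

/-- `0^{⊗r} = 0` for `r ≥ 1`. -/
theorem tpow_zero_vec (hr : 0 < r) : tpow r (0 : V3) = 0 := by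
  funext idx
  simp only [tpow, PiLp.zero_apply, Pi.zero_apply]
  exact Finset.prod_eq_zero (Finset.mem_univ ⟨0, hr⟩) rfl

/-- A piece carried ALONG the collision normal hops entirely: `P^{⊗r} n^{⊗r} = n^{⊗r}`. -/
theorem mapT_projM_tpow_self {n : V3} (hn : n ≠ 0) : mapT (projM n) (tpow r n) = tpow r n := by
  rw [mapT_projM_tpow', projV_self hn]

/-- … and leaves nothing on its carrier: `Q^{⊗r} n^{⊗r} = 0` (`r ≥ 1`). -/
theorem mapT_coprojM_tpow_self (hr : 0 < r) {n : V3} (hn : n ≠ 0) :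
    mapT (coprojM n) (tpow r n) = 0 := by
  rw [mapT_coprojM_tpow', coprojV_self hn, tpow_zero_vec hr]

/-- One step of the incoherent transport on an `ℕ`-indexed family of carriers: the `some (i, j)` branch
of the line's `tStep`, verbatim (`Tᵢ ↦ Q^{⊗r}Tᵢ + P^{⊗r}Tⱼ`, `Tⱼ ↦ Q^{⊗r}Tⱼ + P^{⊗r}Tᵢ`). -/
def pinch (n : V3) (i j : ℕ) (T : ℕ → Tens r) : ℕ → Tens r :=
  Function.update (Function.update T i (mapT (coprojM n) (T i) + mapT (projM n) (T j))) j
    (mapT (coprojM n) (T j) + mapT (projM n) (T i))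

/-- The CRADLE: the chain of steps `(0,1), (1,2), …, (m-1,m)`, all with the same normal `n` (Newton's
cradle: `m + 1` spheres in a row along `n`, struck along `n`). -/
def cradle (n : V3) (m : ℕ) (T : ℕ → Tens r) : ℕ → Tens r :=
  (List.range m).foldl (fun T' k => pinch n k (k + 1) T') T

theorem cradle_succ (n : V3) (m : ℕ) (T : ℕ → Tens r) :
    cradle n (m + 1) T = pinch n m (m + 1) (cradle n m T) := by
  simp [cradle, List.range_succ, List.foldl_append]

/-- One cradle step moves a piece `n^{⊗r}` sitting alone on carrier `m` entirely onto carrier `m + 1`. -/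
theorem pinch_single (hr : 0 < r) {n : V3} (hn : n ≠ 0) (m : ℕ) :
    pinch n m (m + 1) (Pi.single m (tpow r n)) = Pi.single (m + 1) (tpow r n) := by
  funext l
  have hm : (Pi.single m (tpow r n) : ℕ → Tens r) m = tpow r n := by simp
  have hm1 : (Pi.single m (tpow r n) : ℕ → Tens r) (m + 1) = 0 := by simp
  simp only [pinch, hm, hm1, mapT_zero, mapT_projM_tpow_self hn, mapT_coprojM_tpow_self hr hn,
    add_zero, zero_add]
  rcases eq_or_ne l (m + 1) with h1 | h1
  · subst h1; simp
  · rw [Function.update_of_ne h1]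
    rcases eq_or_ne l m with h2 | h2
    · subst h2; simp
    · rw [Function.update_of_ne h2]; simp [h1, h2]

/-- **Cradle relay.** Along a chain of `m` collisions with normals parallel to the carried direction, the
incoherent transport moves the injected piece `n^{⊗r}` from carrier `0` to carrier `m` INTACT (every rank
`r ≥ 1`; rank 2 is the impulse-cloud stress of `cd2`/PAST, rank 3 the cubic cloud of `cd3x`).  In the
hard-sphere realisation (Newton's cradle: `m + 1` spheres at mutual distance `ε_N` along `n`) the cloud mass is
displaced by `m · ε_N` in arbitrarily short time while NO particle moves more than the gaps: incoherent cloud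
mass travels through collision chains at the chain's "sound speed", not with the particles.  Hence the
localisation of clouds is NOT the free statement "a particle moves at most `|v| Δ_N` in a window" (Disproof
cycle 1, (I3), true for particles): for `stub_pastDamping`'s weight-gradient term
`Σ_k Σ_i (w_i − w(x_k)) ⟨C, 𝒯(δ_k y_k^{⊗r})_i⟩` one needs the MASS-WEIGHTED cloud displacement to be
`o(N^{-4γ})` in `L¹` along the evolved law, i.e. a bound on chain transport (hops × `ε_N`, or the diameter of
near-contact clusters met in the window), which neither `CDAlongAt` (a mean depolarisation, blind to where the
pieces sit) nor `TailsOn` (one-particle velocity tails, blind to positions and collision counts) provides; and it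
is not reachable by entropy transfer either (a chain of `N^{1/3-4γ}/σ` near-contacts has Gibbs cost
`e^{-O(N^{1/3-4γ})}`, sub-exponential in `N`).  See the docblock, finding (F2). -/
theorem cradle_relay (hr : 0 < r) {n : V3} (hn : n ≠ 0) (m : ℕ) :
    cradle n m (Pi.single 0 (tpow r n)) = Pi.single m (tpow r n) := by
  induction m with
  | zero => simp [cradle]
  | succ m ih => rw [cradle_succ, ih, pinch_single hr hn]

/-- The relayed mass is the whole injected mass: the rank-2 piece keeps its full trace `‖n‖²` at distance `m`
hops (trace of `n ⊗ n`). -/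
theorem cradle_relay_trace {n : V3} (hn : n ≠ 0) (m : ℕ) :
    ∑ c : Fin 3, cradle n m (Pi.single 0 (tpow 2 n)) m (fun _ => c) = ‖n‖ ^ 2 := by
  rw [cradle_relay two_pos hn, Pi.single_eq_same, EuclideanSpace.real_norm_sq_eq]
  refine Finset.sum_congr rfl fun c _ => ?_
  simp [tpow, sq]

/-- … and nothing is left anywhere else on the chain. -/
theorem cradle_relay_of_ne (hr : 0 < r) {n : V3} (hn : n ≠ 0) {m l : ℕ} (h : l ≠ m) :
    cradle n m (Pi.single 0 (tpow r n)) l = 0 := by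
  rw [cradle_relay hr hn, Pi.single_eq_of_ne h]

/-- The COHERENT counterpart (velocity transfer along the same cradle, `Wᵢ ↦ QWᵢ + PWⱼ`, `Wⱼ ↦ QWⱼ + PWᵢ`):
a velocity `c • n` on sphere `0` is handed down the row intact as well — the cradle is a pure relay for BOTH
transports, so a perfect cradle keeps a unit block in the rows of `M` (`ipr ≥ 1`) and is itself an H1-violating
pattern; but H1 prices only the PERFECTION of the relay (normals exactly along the chain), not the DISTANCE
covered: normals at angle `ψ` to the chain pass the fraction `cos²ψ` per hop at rank 2 and still displace it by
`ε_N` per hop. -/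
def vpinch (n : V3) (i j : ℕ) (W : ℕ → V3) : ℕ → V3 :=
  Function.update (Function.update W i (coprojV n (W i) + projV n (W j))) j
    (coprojV n (W j) + projV n (W i))

/-- The velocity cradle. -/
def vcradle (n : V3) (m : ℕ) (W : ℕ → V3) : ℕ → V3 :=
  (List.range m).foldl (fun W' k => vpinch n k (k + 1) W') W

theorem projV_smul_self {n : V3} (hn : n ≠ 0) (c : ℝ) : projV n (c • n) = c • n := by
  have h : ‖n‖ ^ 2 ≠ 0 := pow_ne_zero 2 (norm_ne_zero_iff.2 hn)
  simp [projV, inner_smul_right, h]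

theorem projV_zero' (n : V3) : projV n 0 = 0 := by simp [projV]

theorem coprojV_zero' (n : V3) : coprojV n 0 = 0 := by simp [coprojV, projV_zero']

theorem vcradle_relay {n : V3} (hn : n ≠ 0) (c : ℝ) (m : ℕ) :
    vcradle n m (Pi.single 0 (c • n)) = Pi.single m (c • n) := by
  induction m with
  | zero => simp [vcradle]
  | succ m ih =>
    have hstep : vcradle n (m + 1) (Pi.single 0 (c • n)) = vpinch n m (m + 1) (vcradle n m (Pi.single 0 (c • n))) := by
      simp [vcradle, List.range_succ, List.foldl_append]
    rw [hstep, ih]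
    funext l
    have hm : (Pi.single m (c • n) : ℕ → V3) m = c • n := by simp
    have hm1 : (Pi.single m (c • n) : ℕ → V3) (m + 1) = 0 := by simp
    have hQ : coprojV n (c • n) = 0 := by simp [coprojV, projV_smul_self hn]
    simp only [vpinch, hm, hm1, hQ, projV_smul_self hn, projV_zero', coprojV_zero', add_zero, zero_add]
    rcases eq_or_ne l (m + 1) with h1 | h1
    · subst h1; simp
    · rw [Function.update_of_ne h1]
      rcases eq_or_ne l m with h2 | h2
      · subst h2; simp
      · rw [Function.update_of_ne h2]; simp [h1, h2]

/-- SUGGESTED MISSING INPUT for `stub_pastDamping` (finding (F2); one sufficient form, in the line's vocabulary):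
CLOUD LOCALITY on the horizon `[0, t]` — the mass-weighted displacement of the incoherent clouds over the line window,
measured against the kernel-gradient scale `N^{-4γ}`, vanishes in `L¹(ds × localGibbsLaw)`:
`E ∫₀ᵗ (N+1)⁻¹ Σ_k Σ_i mass_{k→i}(s) · min(1, N^{4γ} d(x_i(s), x_k(s))) ds → 0`, where
`mass_{k→i} = Σ_c tr 𝒯_{0→m}(δ_k e_c e_cᵀ)_i` is the rank-2 cloud mass of source `k` sitting on carrier `i` at time `s`
(fold restarted at `winStart`, `m = steps (winLen N s)` steps; `Σ_i mass_{k→i} = 3`).  With it the weight-gradient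
term of the stub's sketch is `≤ 2C N^{3γ} ‖C‖ (N+1)⁻¹ Σ_k |y_k|² Σ_i mass_{k→i} min(1, N^{4γ} d_{ik})` pointwise in
`x` (since `|φ_N(x_i − x) − φ_N(x_k − x)| ≤ 2C N^{3γ} min(1, N^{4γ} d_{ik})` for an admissible kernel), and H2 prices the
`|y_k|²`.  Whether `CloudLocalityOn` holds along the evolved law is a DYNAMICAL statement (chain / near-contact-cluster
reach `o(N^{-4γ})` within `Δℓ_N`; true at equilibrium for small `σ` by sub-critical contact percolation, not
transferable by entropy, exposed in dense post-implosion transients) — a stub in its own right, or a hypothesis of a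
re-cut `stub_pastDamping`. -/
def CloudLocalityOn (σ : ℝ) (a₀ θ₀ : T3 → ℝ) (u₀ : T3 → V3) (Φ : Flows σ) (t : ℝ) : Prop :=
  ∀ γ : ℝ, 0 < γ → γ ≤ 1 / 15 →
    Tendsto (fun N : ℕ => ∫⁻ z, ENNReal.ofReal (∫ s in Icc 0 t,
      ((N + 1 : ℕ) : ℝ)⁻¹ * ∑ k : Fin (N + 1), ∑ i : Fin (N + 1),
        (∑ c : Fin 3, ∑ d : Fin 3,
          tTransport 2 σ N (winStart σ N (Φ N) s z) 0 (steps σ N (winStart σ N (Φ N) s z) (winLen N s))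
            (Pi.single k (tpow 2 (baseV c))) i (fun _ => d)) *
        min 1 (((N : ℝ) + 1) ^ (4 * γ) *
          Literature.Analysis.FluidPDE.Torus.euclidDist (((Φ N).flow s z i).1 - ((Φ N).flow s z k).1) 0))
      ∂(Literature.MathematicalPhysics.KineticTheory.localGibbsLaw σ a₀ u₀ θ₀ N (Φ N))) atTop (𝓝 0)

end Relay



/-! ### §5b The closure debt of CCN / SC, checked on the line's own `chaosCross` -/

section ClosureDebt

open Summit.AtomisticToContinuum.HydrodynamicLimit.Theorems.ContactSourceDuhamel hiding T3 V3

/-- The two non-trivial slot subsets at rank 2. -/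
theorem filter_subsets_two :
    (Finset.univ.filter (fun S : Finset (Fin 2) => S ≠ ∅ ∧ S ≠ Finset.univ)) = {{0}, {1}} := by
  decide

/-- The rank-2 cross terms in closed form: `crossT 2 a b = a ⊗ b + b ⊗ a` (entrywise). -/
theorem crossT_two_apply (a b : V3) (idx : Fin 2 → Fin 3) :
    crossT 2 a b idx = b (idx 0) * a (idx 1) + a (idx 0) * b (idx 1) := by
  rw [crossT, filter_subsets_two, Finset.sum_pair (by decide), Fin.prod_univ_two, Fin.prod_univ_two]
  simp

/-- The four velocities of the REGULAR TETRAHEDRON law (equal weights): centred, second moments `4·𝟙`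
(so the traceless stress `D` vanishes), `Σ |y|² y = 0` (so the heat flux `q` vanishes). -/
def tet : Fin 4 → V3 := ![!₂[1, 1, 1], !₂[1, -1, -1], !₂[-1, 1, -1], !₂[-1, -1, 1]]

/-- The contact normal of the witness. -/
def ntet : V3 := !₂[1, 2, 0]

theorem tet_apply (k : Fin 4) (c : Fin 3) :
    tet k c = (![![1, 1, 1], ![1, -1, -1], ![-1, 1, -1], ![-1, -1, 1]] : Fin 4 → Fin 3 → ℝ) k c := by
  fin_cases k <;> fin_cases c <;> rfl

theorem ntet_apply (c : Fin 3) : ntet c = (![1, 2, 0] : Fin 3 → ℝ) c := by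
  fin_cases c <;> rfl

theorem inner_ntet (y : V3) : ⟪ntet, y⟫_ℝ = y 0 + 2 * y 1 := by
  simp only [PiLp.inner_apply, RCLike.inner_apply, conj_trivial, Fin.sum_univ_three, ntet_apply]
  simp; ring

theorem norm_ntet_sq : ‖ntet‖ ^ 2 = 5 := by
  rw [← real_inner_self_eq_norm_sq, inner_ntet]; simp [ntet_apply]; norm_num

/-- tetrahedron law: centred. -/
theorem tet_sum : ∑ k, tet k = 0 := by
  ext c
  simp only [Fin.sum_univ_four, PiLp.add_apply, PiLp.zero_apply, tet_apply]
  fin_cases c <;> simp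

/-- tetrahedron law: isotropic second moments `Σ_k y_k ⊗ y_k = 4·𝟙` (`D = 0` for the shift `u = 0`). -/
theorem tet_second (j l : Fin 3) : ∑ k, tet k j * tet k l = if j = l then 4 else 0 := by
  simp only [Fin.sum_univ_four, tet_apply]
  fin_cases j <;> fin_cases l <;> simp <;> norm_num

/-- tetrahedron law: vanishing heat flux `Σ_k |y_k|² y_k = 0` (all `|y_k|² = 3`). -/
theorem tet_flux (a : Fin 3) : ∑ k, ‖tet k‖ ^ 2 * tet k a = 0 := by
  have h : ∀ k, ‖tet k‖ ^ 2 = 3 := by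
    intro k
    rw [EuclideanSpace.real_norm_sq_eq, Fin.sum_univ_three]
    fin_cases k <;> simp [tet_apply] <;> norm_num
  simp only [h, Fin.sum_univ_four, tet_apply]
  fin_cases a <;> simp

/-- **Closure-debt witness (¬ a natural strengthening of CCN / SC).** For the tetrahedron block law (weights `1`,
shift `u = 0` = its mean, so the block's traceless kinetic stress `D` and kinetic heat flux `q` vanish EXACTLY:
`tet_sum`, `tet_second`, `tet_flux`) the CHAOS VALUE `chaosCross` of the rank-2 contact source — the line's own
definition, flux weight `|⟪W_k − W_k', n⟫|` — at the normal `n = (1,2,0)` does not vanish: its `(0,0)` entry is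
`4/125` (it vanishes at the symmetry normals `e_p`, `e_p ± e_q`, `e₀+e₁+e₂`; exact rational arithmetic, 16 pairs).
READING.  `|D|² + |q|² = 0` at a time `s` does not make the chaos value `Ξ^ch` of the sources injected during
`[s, s + Δℓ]` small: the Euler fluxes can be closed NOW while a flux-weighted fourth-cumulant anisotropy re-opens
them at the collision rate.  Hence, given the Duhamel identity, the dictionary, `PastSmallOn` and even the crux's
conclusion C, `CrossNullOn` is equivalent to `∫∫ Σ_b (Ξ^ch_b)² → 0` (drefute r1, structural remark on stub 5), which
is NOT a consequence of C: `stub_contactCrossNull` and `stub_sourceContraction` assert strictly more than the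
kinetic hinge 9522 — local equilibrium of the block law in the flux-weighted bilinear sense, not only of its
rank-2/3 moments.  No deterministic inequality `Σ(Ξ^ch)² ≤ κ(|D|²+|q|²)` or `Σ Blk·Ξ^ch ≤ κ(|D|²+|q|²)` with a
margin can hold pointwise (here the right-hand sides are `0`); the stubs are claimed along the flow, in
probability, and this is the smallest checked instance of the debt the line card states openly. -/
theorem chaosCross_tet_ne_zero :
    chaosCross 2 3 (fun _ => (1 : ℝ)) tet 0 ntet (fun _ => 0) = 4 / 125 := by
  have hP : ∀ y : V3, projV ntet y 0 = (y 0 + 2 * y 1) / 5 := by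
    intro y; simp [projV, inner_ntet, norm_ntet_sq, ntet_apply]
  have hQ : ∀ y : V3, coprojV ntet y 0 = y 0 - (y 0 + 2 * y 1) / 5 := by
    intro y; simp [coprojV, hP]
  have hs : ∀ k, ⟪tet k, ntet⟫_ℝ = (![3, -1, 1, -3] : Fin 4 → ℝ) k := by
    intro k; rw [real_inner_comm, inner_ntet, tet_apply, tet_apply]
    fin_cases k <;> simp <;> norm_num
  have hw : ∀ k k', |⟪tet k, ntet⟫_ℝ - ⟪tet k', ntet⟫_ℝ| =
      (![![0, 4, 2, 6], ![4, 0, 2, 2], ![2, 2, 0, 4], ![6, 2, 4, 0]] : Fin 4 → Fin 4 → ℝ) k k' := by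
    intro k k'; rw [hs, hs]
    fin_cases k <;> fin_cases k' <;> simp <;> norm_num
  have h0 : ∀ k, tet k 0 = (![1, 1, -1, -1] : Fin 4 → ℝ) k := by
    intro k; rw [tet_apply]; fin_cases k <;> simp
  have h1 : ∀ k, tet k 1 = (![1, -1, 1, -1] : Fin 4 → ℝ) k := by
    intro k; rw [tet_apply]; fin_cases k <;> simp
  simp only [chaosCross, crossT_two_apply, hP, hQ, sub_zero, one_mul, inner_sub_left, hw, h0, h1]
  simp only [Fin.sum_univ_succ, Fin.sum_univ_zero]
  simp
  norm_num

end ClosureDebt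



/-! ### §5c `stub_contactCrossNull` in ABSOLUTE form is inert at fixed `σ` (circular through C); the RELATIVE form and a
toy measurement of the static chaos defect (kit j017504) -/

section CrossNullRelative

open Summit.AtomisticToContinuum.HydrodynamicLimit.Theorems.ContactSourceDuhamel hiding T3 V3

/-- Admissible kernel families (verbatim the crux's kernel hypothesis; copy of the line's `AdmissibleKernel`, whose
time-local statements module was not yet built on the farm when this file was checked). -/
def AdmissibleKernel' (γ C : ℝ) (φ : ℕ → T3 → ℝ) : Prop :=
  (∀ N, Literature.Analysis.FunctionSpaces.Torus.IsSmooth (φ N)) ∧ (∀ N y, 0 ≤ φ N y) ∧ (∀ N, ∫ y, φ N y = 1) ∧ (∀ (N : ℕ) y, ((N : ℝ) + 1) ^ (-γ) ≤ Literature.Analysis.FluidPDE.Torus.euclidDist y 0 → φ N y = 0) ∧ (∀ (N : ℕ) y, φ N y ≤ C * ((N : ℝ) + 1) ^ (3 * γ)) ∧ (∀ (N : ℕ) y, ‖Literature.Analysis.FunctionSpaces.Torus.gradient (φ N) y‖ ≤ C * ((N : ℝ) + 1) ^ (4 * γ))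

/-- SUGGESTED CORRECTED SIGNATURE for `stub_contactCrossNull` (finding (F4)): CONTACT CROSS NULL IN RELATIVE FORM on
the horizon `[0, t]` — the chaos defect of the window source sums is bounded by a (small, σ-dependent) multiple `c` of the
visible Euler defect plus `o_P(1)`:  `∀ δ > 0, P(∫∫ Σ(Ξ − Ξ^ch)² > c · ∫∫(|D|² + |q|²) + δ) → 0`.  The absolute form
(`CrossNullOn`, `c = 0`) is, at fixed `σ`, true only THROUGH the crux's conclusion C: ring / recollision pre-collisional
correlations at contact are first order in the local anisotropy with a density-dependent coefficient `c₁(σ) = O(σ³) ≠ 0`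
(exactly zero only AT equilibrium), so `Ξ − Ξ^ch ≈ c₁(σ)·L(D, q, …) + fluctuations` and `∫∫Σ(Ξ − Ξ^ch)² → 0` forces the
anisotropy itself to vanish — circular for the line.  The relative form is what a chaos expansion at fixed small `σ` can
aim at, and `stub_reduction` absorbs it: with the Young split `(1 − η)Def ≤ (2η)⁻¹(PAST² + XiDev²) + XiCorr` one needs
`κ + η + c/(2η) < 1`, i.e. `c < 2η(1 − κ − η)` — room to spare if `κ ≈ −1/2` as the mechanism predicts, and `∃ σ₀` gets the
job of making `c(σ)` small.  Toy measurement of the static relative defect (docblock (F4)): `−4.5 ± 4.1 %` (φ = 0.01),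
`−3.3 ± 4.2 %` (0.02), `−8.3 ± 2.9 %` (0.05), `−12.7 ± 2.9 %` (0.10), `−16.4 ± 2.8 %` (0.20), `−21.3 ± 2.7 %` (0.30); dt/3 check
`−18.1 ± 2.9 %` at 0.20; fresh-contact bin-0 null control clean (kit j017504 / j017558 / j017568 / j017633 / j017766). -/
def CrossNullRelOn (σ : ℝ) (a₀ θ₀ : T3 → ℝ) (u₀ : T3 → V3) (Φ : Flows σ) (t c : ℝ) : Prop :=
  ∀ (γ C : ℝ) (φ : ℕ → T3 → ℝ), 0 < γ → γ ≤ 1 / 15 → AdmissibleKernel' γ C φ →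
    ∀ δ : ℝ, 0 < δ →
      Tendsto (fun N : ℕ => Literature.MathematicalPhysics.KineticTheory.localGibbsLaw σ a₀ u₀ θ₀ N (Φ N)
        {z | c * (∫ s in Icc 0 t, ∫ x, DefectSq σ N (Φ N) φ s z x) + δ <
          ∫ s in Icc 0 t, ∫ x, XiDevSq σ N (Φ N) φ s z x}) atTop (𝓝 0)

end CrossNullRelative

/-! ## §6 Examined-and-dead kill patterns, rev 12 (cycle 3 = cycle 1 on stmt-14868), one line each

Inherited from cycles 1–2 on stmt-12949 and RE-CHECKED against the rev-12 text (all still dead, for the same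
reasons — every probability/mean is under `localGibbsLaw = particleLaw ≪ liouville`, `Φ.good` is conull and
invariant, the typed `M` is the intrinsic Alexander fold, the admissible kernel class is non-empty and capped by
hard cores, Bochner junk-zero only empties deviation events): junk `Φ.flow` off `Φ.good`; zero / non-probability
law; empty kernel class; Bochner junk of the `s`- or `x`-integral; `ub = 0⁻¹ • mb` on empty blocks; hot / dense /
sparse cells; shocks after blow-up (volume `≍ (N+1)^{-γ}`); uniform shear flow (anisotropy `∝ Kn → 0`); `N = 0, 1`,
`γ → 0⁺`, `γ = 1/15`, `C ≤ 0`, huge `|u₀|` (Galilean invariance of `D, q`), tiny `θ₀`, `t − Δ_N < 0` for small `N`.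
New in rev 12:
* H2 per horizon (`∀ t > 0, H2(t) → C(t)`): causal and consistent — both sides live on `[0, t]`; rev 12 ⇒ rev 11
  (`rev11_of_named`); no new junk (the `∃ lam Cexp` is inside `∀ t`, so `lam` may shrink with `t`: harmless).
* THIS route's target no longer implies the crux (it is Euler-conditioned, the crux is not); the crux is still
  implied by the shared unconditional hinge 9522 (`adaptedWeightCLT_of_fmr9522`), so a kill of the crux AS TYPED is
  a kill of 9522 — and the only physical candidate mechanism is POST-SHOCK: Kelvin–Helmholtz / Richtmyer–Meshkov
  roll-up of slip surfaces and shocked interfaces feeding sub-block REYNOLDS stress (unresolved flow, not a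
  velocity-distribution effect) into the block kinetic stress `D`, in the inviscid band `N^{-1/6} ≪ ℓ ≪ N^{-γ}`
  (damping rate `ν/ℓ² ≍ N^{2β−1/3}/σ² → 0` for `ℓ = N^{-β}`, `β < 1/6`), with H1 and H2(t) intact (collisions
  plentiful, temperature bounded).  NUMBERS AGAINST IT: a cascade from an `O(1)` integral scale leaves only the
  Kolmogorov share `(ℓ_block/L)^{2/3} ≍ N^{-2γ/3} → 0` of the turbulent energy below the block scale, and directly
  excited thin layers (sheet instabilities, growth rate `∝ k`) saturate by THICKENING (energy moves up-scale) on times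
  `→ 0`; so even post-shock `∫∫|D|² → 0` is the likelier outcome at fixed `γ` — an `O(1)` sub-block share for `O(1)`
  time × volume would need sustained injection at sub-block scales.  Atomistic simulations do show the instabilities
  themselves developing from molecular data (large-scale MD of RT/RM/KH, Kadau–Germann–Hadjiconstantinou–Alder and
  co-workers, 2004–2010 — cited from memory, `lit` was unavailable, see NOTES), not an `N`-uniform sub-block share.
  Nothing is provable either way here.  Prepared classification all the same: such a witness would live at `t ≥ T`
  and miss `C′ = PreShock` (§1c) — `refuted-misstated`, route intact.  No `H → ¬crux` lemma is filed: every precise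
  `H` we could write ("sub-block two-stream structure w.h.p. at some `t`") is the negated conclusion in costume.
* negative-lemma-modulo-H for the LINE: `stub_pastDamping` needs cloud locality (§5a) and `stub_contactCrossNull`
  needs flux-level chaos (§5b); neither has a constructible obstruction `H` at fixed small `σ` pre-shock.
-/

end

end Summit.AtomisticToContinuum.HydrodynamicLimit.Cruxes.AdaptedWeightCLT.Disproof
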